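import Literature.Topology.FourManifolds.PlumbingMapOrientation
import Literature.Topology.FourManifolds.PlumbingHomology
import Literature.Topology.FourManifolds.TreeShapedUnionHomology
import Literature.Topology.FourManifolds.SphereProductTubeCollapse
import Literature.Topology.FourManifolds.CompatibleOrientationRestrict
import Literature.Topology.FourManifolds.TopologicalConnectedSumOrientation
import Literature.AlgebraicTopology.SingularHomology.OrientationCover
import Literature.Topology.FourManifolds.SphereProductTubeVertexData
import Literature.Topology.FourManifolds.ClosedModelAmbientCollapse
import Literature.Topology.FourManifolds.SphereProductOpenTubeHomology
import Literature.Topology.FourManifolds.HomotopySpheresE8KroneckerTable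
import Literature.Topology.FourManifolds.SmoothOrientationProofs
import HarnessLib

/-!
# The `E₈` plumbing `M(4m)`: coherent orientation, Kronecker datum, and the `E₈` fact modulo `π₁(∂M) = 1` and stable parallelisability

Topic `Literature/Topology/FourManifolds` (fact seat of
`Literature.Topology.FourManifolds.HomotopySphere.exists_intersectionForm_equivalent_e8Form`,
A. Kosinski, *Differential Manifolds* (1993), VI.12 pp. 119–122, IX.(7.5), X §6 p. 216), on the
tree's model of Kosinski's plumbing: the open plumbing `Plumbing.PV` of eight tubes of the diagonal
of `Sᵏ × Sᵏ` along the `E₈` tree (`PlumbingGlue.lean`), its size function `ρ` and the compact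
plumbing `W = M(4m) = {ρ ≤ ε}` (`PlumbingFunction.lean`, `PlumbingHomology.lean`). Three parts:

1. **Coherent orientation** (`Plumbing.exists_orientation_rho_lt`): for `k` even, one
   `ℤ`-orientation `μ₀` of `Sᵏ × Sᵏ` and one of `{ρ < ε}` under which all eight piece maps are
   orientation preserving (Kosinski VI.12 p. 120: the pieces of `M(4n)` are oriented coherently;
   uses `PlumbingMapOrientation.lean`: the plumbing map preserves the local orientation at the
   crossing point for `k` even), after `{ρ < ε}` is shown simply connected
   (`Plumbing.simplyConnectedSpace_rho_lt`, van Kampen along the tree).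
2. **The Kronecker datum** (`Plumbing.exists_kroneckerData`): a relative fundamental class of `W`
   and the vertex models / collapses / Thom classes / core spheres with `⟨uᵥ, πᵥ₊ gᵥ⟩ = 2`
   ((12.4)), `|⟨u_w, π_w₊ gᵥ⟩| = Γ₈(v, w)` ((12.3)) and ONE sign `r`, in the exact shape consumed
   by `HomotopySphere.exists_intersectionForm_equivalent_e8Form_of_kroneckerData`
   (`HomotopySpheresE8KroneckerTable.lean`).
3. **Assembly** (`HomotopySphere.exists_intersectionForm_equivalent_e8Form_of_plumbing`): the
   named fact from the two remaining geometric inputs of Kosinski's argument for this `W` —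
   `π₁(∂M(4m)) = 1` (VI.(12.1)) and stable parallelisability (IX.(7.5)) — taken as hypotheses.

Everything is proved; no definitions, no named facts (D-0026).

## References

* A. Kosinski, *Differential Manifolds*, Academic Press 1993, VI.(11.5), VI.12 pp. 119–122
  ((12.1)–(12.4)), IX.(7.5) p. 188, X §6 p. 216. [Kosinski1993]
* J. Milnor, J. Stasheff, *Characteristic classes*, Princeton 1974, §11 Thm. 11.1, Cor. 11.2,
  §18 p. 205. [MilnorStasheff1974]
* A. Hatcher, *Algebraic Topology*, CUP 2002, Prop. 1.14, Lemma 1.15, §3.3 Prop. 3.25, Thm. 3.26,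
  pp. 231–236, p. 241, p. 253. [HatcherAT2002]
* M. Kervaire, J. Milnor, *Groups of homotopy spheres: I*, Ann. of Math. 77 (1963), §7
  footnote pp. 528–529. [KervaireMilnorAnnals1963]
-/

/-!
## Part 1. A coherent orientation of the `E₈` plumbing: one orientation of `Sᵏ × Sᵏ` for all eight pieces

Topic `Literature/Topology/FourManifolds` (fact seat of
`Literature.Topology.FourManifolds.HomotopySphere.exists_intersectionForm_equivalent_e8Form`,
Kosinski's `E₈` plumbing `M(4m)`, *Differential Manifolds* (1993), VI.12), on the tree's model
`Plumbing.PV` (`PlumbingGlue.lean`: eight tubes `ι v : N → PV` of the diagonal of `Sᵏ × Sᵏ`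
glued by the plumbing maps) and its size function `ρ` (`PlumbingFunction.lean`; `M(4m) = {ρ ≤ ε}`,
interior `{ρ < ε}`). Kosinski, VI.12 p. 120 and (12.4): the pieces of `M(4n)` are oriented
COHERENTLY (all eight self-intersection numbers are `+2`, the form is the positive definite `E₈`);
in the tree's homological language:

* `Plumbing.simplyConnectedSpace_rho_lt` — `{ρ < ε}` is simply connected (`k ≥ 2`, `ε > 0`):
  a tree-shaped union of eight open pieces homotopy equivalent to `Sᵏ` with contractible edge
  intersections (`PlumbingHomology.lean`, `TreeShapedUnionHomology.lean`; Kosinski VI.(11.5));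
  hence `{ρ < ε}` is `ℤ`-orientable (Hatcher Prop. 3.25);
* **`Plumbing.exists_orientation_rho_lt`** — for `k` even there are a `ℤ`-orientation `μ₀` of
  `Sᵏ × Sᵏ` and a `ℤ`-orientation `ν` of `{ρ < ε}` such that EVERY piece map
  `x ↦ ι v x : O → {ρ < ε}` (`O ⊆ N` open, `ρ̂ᵥ < ε` on `O`, any `v`) carries the local classes of
  `μ₀` (excised to `O`) to those of `ν`:
  the eight pieces are read in ONE oriented copy of `Sᵏ × Sᵏ`. The signs agree across the seven
  edges because the plumbing map preserves the local orientation at the crossing point for `k`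
  even (`Plumbing.map_plumbMap_openSubsetIso_inv_localClass`, `PlumbingMapOrientation.lean`),
  and the `E₈` tree is connected.

Everything is proved; no definitions, no named facts (D-0026).

## References

* A. Kosinski, *Differential Manifolds*, Academic Press 1993, VI.(11.5), VI.12 pp. 120–122,
  (12.4). [Kosinski1993]
* A. Hatcher, *Algebraic Topology*, CUP 2002, Prop. 1.14, Lemma 1.15 (van Kampen for a union),
  §3.3 Prop. 3.25, pp. 231–236. [HatcherAT2002]
-/

open scoped Manifold ContDiff Topology RealInnerProductSpace
open Set Function CategoryTheory CategoryTheory.Limits Topology TopologicalSpace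

noncomputable section

namespace Literature.Topology.FourManifolds

open Literature.AlgebraicTopology.SingularHomology

/-! ### Generic lemmas on restricted orientations -/

section Generic

variable {N : ℕ} {M : Type} [TopologicalSpace M] [T2Space M]
  [ChartedSpace (EuclideanSpace ℝ (Fin N)) M]

omit [ChartedSpace (EuclideanSpace ℝ (Fin N)) M] in
/-- The inclusion of an open subset is injective on local homology (excision isomorphism),
`Opens` form. [cite: HatcherAT2002, §3.3 p. 231] -/
theorem map_valC_localHomology_injective (U : Opens M) (y : U) {q : M} (hq : (y : M) = q)
    (h : MapsTo (HomologicalOrientation.valC U) ({y}ᶜ : Set U) ({q}ᶜ : Set M)) :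
    Injective (relativeSingularHomology.map ℤ ℤ (HomologicalOrientation.valC U) h N) := by
  subst hq
  haveI := localHomology.isIso_map_of_isOpenEmbedding_of_eq ℤ ℤ (HomologicalOrientation.valC U)
    (HomologicalOrientation.isOpenEmbedding_valC U) y rfl N
  exact (asIso (relativeSingularHomology.map ℤ ℤ (HomologicalOrientation.valC U) h N)).toLinearEquiv.injective

/-- **Restriction is transitive on local classes**: for opens `U ⊆ V` the inclusion `U → V`
carries `(μ|U)_y` to `(μ|V)_y`. [cite: HatcherAT2002, §3.3 p. 231] -/
theorem _root_.Literature.AlgebraicTopology.SingularHomology.HomologicalOrientation.map_inclusion_restrictOpens_localClass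
    (μ : HomologicalOrientation ℤ M N)
    {U V : Opens M} (hUV : (U : Set M) ⊆ V) (y : U)
    (h : MapsTo (⟨fun z : U => (⟨z.1, hUV z.2⟩ : V), by fun_prop⟩ : C(U, V)) ({y}ᶜ : Set U)
      ({(⟨y.1, hUV y.2⟩ : V)}ᶜ : Set V)) :
    relativeSingularHomology.map ℤ ℤ (⟨fun z : U => (⟨z.1, hUV z.2⟩ : V), by fun_prop⟩ : C(U, V)) h N
        ((μ.restrictOpens U).localClass y) = (μ.restrictOpens V).localClass ⟨y.1, hUV y.2⟩ := by
  have mV : MapsTo (HomologicalOrientation.valC V) ({(⟨y.1, hUV y.2⟩ : V)}ᶜ : Set V)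
      ({(y : M)}ᶜ : Set M) := LocalFamily.mapsTo_compl_pt Subtype.val_injective _
  apply map_valC_localHomology_injective V ⟨y.1, hUV y.2⟩ rfl mV
  rw [HomologicalOrientation.map_val_restrictOpens_localClass, ← ModuleCat.comp_apply,
    ← relativeSingularHomology.map_comp]
  exact HomologicalOrientation.map_val_restrictOpens_localClass μ U y

/-- **The restricted local class is the excised local class**: `(μ|U)_y = μ_y|U`.
[cite: HatcherAT2002, §3.3 p. 231] -/
theorem _root_.Literature.AlgebraicTopology.SingularHomology.HomologicalOrientation.restrictOpens_localClass_eq_openSubsetIso_inv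
    (μ : HomologicalOrientation ℤ M N) (U : Opens M) (y : U) :
    (μ.restrictOpens U).localClass y =
      (localHomology.openSubsetIso ℤ ℤ U.2 y.2 N).inv (μ.localClass y.1) := by
  have mU : MapsTo (subsetIncl (U : Set M)) ({(⟨y.1, y.2⟩ : ↥(U : Set M))}ᶜ : Set _)
      ({(y : M)}ᶜ : Set M) := LocalFamily.mapsTo_compl_pt Subtype.val_injective _
  apply map_subsetIncl_localHomology_injective (N := N) U.2 y.2 mU
  rw [map_subsetIncl_openSubsetIso_inv U.2 y.2 mU]
  exact HomologicalOrientation.map_val_restrictOpens_localClass μ U y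

omit [T2Space M] [ChartedSpace (EuclideanSpace ℝ (Fin N)) M] in
/-- Excision is transitive: for opens `U ⊆ U'` containing `x`, the inclusion `U → U'` carries
`μₓ|U` to `μₓ|U'`. [cite: HatcherAT2002, §3.3 p. 231] -/
theorem map_inclusion_openSubsetIso_inv [T1Space M] {U U' : Set M} (hU : IsOpen U) (hU' : IsOpen U')
    (hUU' : U ⊆ U') {x : M} (hx : x ∈ U) (a : localHomology ℤ ℤ M x N)
    (h : MapsTo (⟨Set.inclusion hUU', continuous_inclusion hUU'⟩ : C(↥U, ↥U')) ({(⟨x, hx⟩ : ↥U)}ᶜ : Set _)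
      ({(⟨x, hUU' hx⟩ : ↥U')}ᶜ : Set _)) :
    relativeSingularHomology.map ℤ ℤ (⟨Set.inclusion hUU', continuous_inclusion hUU'⟩ : C(↥U, ↥U')) h N
        ((localHomology.openSubsetIso ℤ ℤ hU hx N).inv a) =
      (localHomology.openSubsetIso ℤ ℤ hU' (hUU' hx) N).inv a := by
  have m' : MapsTo (subsetIncl U') ({(⟨x, hUU' hx⟩ : ↥U')}ᶜ : Set _) ({x}ᶜ : Set M) :=
    LocalFamily.mapsTo_compl_pt Subtype.val_injective _
  have m : MapsTo (subsetIncl U) ({(⟨x, hx⟩ : ↥U)}ᶜ : Set _) ({x}ᶜ : Set M) :=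
    LocalFamily.mapsTo_compl_pt Subtype.val_injective _
  apply map_subsetIncl_localHomology_injective (N := N) hU' (hUU' hx) m'
  rw [map_subsetIncl_openSubsetIso_inv hU' (hUU' hx) m', ← ModuleCat.comp_apply,
    ← relativeSingularHomology.map_comp]
  exact map_subsetIncl_openSubsetIso_inv hU hx m a

omit [T2Space M] [ChartedSpace (EuclideanSpace ℝ (Fin N)) M] in
/-- Corestricting an open embedding to an open set containing its range gives an open embedding.
[folklore] -/
theorem isOpenEmbedding_codRestrict_of_isOpenEmbedding {Y : Type} [TopologicalSpace Y] {f : Y → M}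
    (hf : IsOpenEmbedding f) {W : Set M} (hW : ∀ y, f y ∈ W) :
    IsOpenEmbedding (fun y => (⟨f y, hW y⟩ : ↥W)) := by
  refine IsOpenEmbedding.of_continuous_injective_isOpenMap (hf.continuous.subtype_mk _)
    (fun a b hab => hf.injective (congrArg Subtype.val hab)) fun V hV => ?_
  have : (fun y => (⟨f y, hW y⟩ : ↥W)) '' V = Subtype.val ⁻¹' (f '' V) := by
    ext z
    constructor
    · rintro ⟨y, hy, rfl⟩; exact ⟨y, hy, rfl⟩
    · rintro ⟨y, hy, hyz⟩; exact ⟨y, hy, Subtype.ext hyz⟩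
  rw [this]
  exact (hf.isOpenMap V hV).preimage continuous_subtype_val

end Generic

namespace Plumbing

variable {k n : ℕ} {c ε : ℝ} (hk : 2 ≤ k) (hc : IsParam c) (hkn : k + k = n + 1)

/-! ### `{ρ < ε}` is simply connected -/

/-- **The interior `{ρ < ε}` of the plumbing is simply connected** (`k ≥ 2`, `ε > 0`): the cover
by the eight open pieces `A_v(ε) ≃ Sᵏ` is tree-shaped along the `E₈` tree with contractible edge
intersections (`PlumbingHomology.lean`), so van Kampen along the tree applies
(`simplyConnectedSpace_of_treeCover`). Kosinski VI.(11.5): a `(2k, k)`-handlebody has the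
homotopy type of a wedge of `k`-spheres. [cite: Kosinski1993, VI.(11.5)] [cite: HatcherAT2002, Lemma 1.15 and Prop. 1.14] -/
theorem simplyConnectedSpace_rho_lt (hε : 0 < ε) :
    SimplyConnectedSpace ↥{p : PV k c hk hc hkn | rho hk hc hkn p < ε} := by
  set Xs : Set (PV k c hk hc hkn) := {p | rho hk hc hkn p < ε} with hXs
  have hAX : ∀ v, pieceA hk hc hkn v ε ⊆ Xs := fun v p hp => rho_lt_of_mem_pieceA hk hc hkn hp
  refine simplyConnectedSpace_of_treeCover (r := 7) (fun v => (Subtype.val ⁻¹' pieceA hk hc hkn v ε : Set ↥Xs))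
    par par_lt (fun v => (isOpen_pieceA hk hc hkn v ε).preimage continuous_subtype_val) ?_ ?_ ?_ ?_
  · ext p
    simp only [mem_iUnion, mem_preimage, mem_univ, iff_true]
    exact exists_mem_pieceA_of_rho_lt hk hc hkn p.2
  · intro v w hwv hne
    have hΓ : kosinskiGamma8 v w ≠ 1 := by
      rw [gamma8_comm]; exact gamma8_ne_one_of_lt w v hwv hne
    rw [Set.disjoint_iff_inter_eq_empty, ← preimage_inter,
      pieceA_inter_pieceA_of_ne_one hk hc hkn (ne_of_gt hwv) hΓ, preimage_empty]
  · intro v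
    have h1 : IsSimplyConnected (pieceA hk hc hkn v ε) := by
      rw [pieceA, (isOpenEmbedding_ι hk hc hkn v).isEmbedding.isSimplyConnected_image]
      haveI := SphereProd.simplyConnectedSpace_sphere hk
      exact (pieceTHomotopyEquiv hk hc v hε).simplyConnectedSpace
    have h2 : (Subtype.val '' (Subtype.val ⁻¹' pieceA hk hc hkn v ε : Set ↥Xs) : Set (PV k c hk hc hkn)) =
        pieceA hk hc hkn v ε := by
      rw [image_preimage_eq_inter_range, Subtype.range_coe]
      exact inter_eq_left.2 (hAX v)
    rw [← Topology.IsEmbedding.subtypeVal.isSimplyConnected_image, h2]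
    exact h1
  · intro v hv
    have hΓ : kosinskiGamma8 v (par v) = 1 := by rw [gamma8_comm]; exact gamma8_par v hv
    haveI := contractibleSpace_inter hk hc hkn hΓ hε
    have hsub : pieceA hk hc hkn v ε ∩ pieceA hk hc hkn (par v) ε ⊆ Xs := fun p hp => hAX v hp.1
    have hcont : Continuous fun p : ↥(pieceA hk hc hkn v ε ∩ pieceA hk hc hkn (par v) ε) =>
        (⟨p.1, hsub p.2⟩ : ↥Xs) := by fun_prop
    have hr := isPathConnected_range hcont
    have hrange : range (fun p : ↥(pieceA hk hc hkn v ε ∩ pieceA hk hc hkn (par v) ε) =>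
        (⟨p.1, hsub p.2⟩ : ↥Xs)) =
        (Subtype.val ⁻¹' pieceA hk hc hkn v ε : Set ↥Xs) ∩ Subtype.val ⁻¹' pieceA hk hc hkn (par v) ε := by
      ext q
      constructor
      · rintro ⟨p, rfl⟩; exact p.2
      · intro hq; exact ⟨⟨q.1, hq⟩, rfl⟩
    rw [hrange] at hr
    exact hr

/-! ### The piece maps -/

/-- A point `x` of the tube with `ρ̂ᵥ(x) < ε` is carried by `ι v` into `{ρ < ε}`. [folklore] -/
theorem pieceMap_mem (v : Fin 8) (x : (Metric.sphere (0 : EuclideanSpace ℝ (Fin (k + 1))) 1) ×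
    (Metric.sphere (0 : EuclideanSpace ℝ (Fin (k + 1))) 1)) (h : c < fibHt x ∧ rhoHat k c v x < ε) :
    ι hk hc hkn v ⟨x, h.1⟩ ∈ {p : PV k c hk hc hkn | rho hk hc hkn p < ε} := by
  change rho hk hc hkn (ι hk hc hkn v ⟨x, h.1⟩) < ε
  rw [rho_ι]; exact h.2

/-- **The piece maps are open embeddings**: for an open `O ⊆ Sᵏ × Sᵏ` contained in the tube and
on which `ρ̂ᵥ < ε`, the map `x ↦ ι v x : O → {ρ < ε}` is an open embedding (`ι v` is one,
`PlumbingGlue.lean`). [cite: Kosinski1993, VI.12 p. 120] -/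
theorem isOpenEmbedding_pieceMap (v : Fin 8)
    (O : Opens ((Metric.sphere (0 : EuclideanSpace ℝ (Fin (k + 1))) 1) ×
      (Metric.sphere (0 : EuclideanSpace ℝ (Fin (k + 1))) 1)))
    (hO : ∀ x ∈ O, c < fibHt x ∧ rhoHat k c v x < ε) :
    IsOpenEmbedding fun x : ↥O =>
      (⟨ι hk hc hkn v ⟨x.1, (hO x.1 x.2).1⟩, pieceMap_mem hk hc hkn v x.1 (hO x.1 x.2)⟩ :
        ↥{p : PV k c hk hc hkn | rho hk hc hkn p < ε}) := by
  have hsub : (O : Set _) ⊆ (Tb k c : Set _) := fun x hx => (hO x hx).1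
  have h1 : IsOpenEmbedding (Set.inclusion hsub) :=
    IsOpenEmbedding.inclusion hsub (O.2.preimage continuous_subtype_val)
  have h2 : IsOpenEmbedding (fun x : ↥O => ι hk hc hkn v (Set.inclusion hsub x)) :=
    (isOpenEmbedding_ι hk hc hkn v).comp h1
  exact isOpenEmbedding_codRestrict_of_isOpenEmbedding h2 fun x => pieceMap_mem hk hc hkn v x.1 (hO x.1 x.2)

/-! ### The coherent orientation -/

set_option maxHeartbeats 1600000 in
/-- **A coherent orientation of the `E₈` plumbing** (Kosinski VI.12 p. 120, (12.4): the pieces of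
`M(4n)` are oriented coherently, so that all eight self-intersection numbers are `+2`). Let
`k ≥ 2` be even, `k + k = n + 1`, `c` admissible, `ε > 0`. There are a `ℤ`-orientation `μ₀` of
`Sᵏ × Sᵏ` and a `ℤ`-orientation `ν` of the interior `{ρ < ε} ⊆ PV` of the plumbing (in degree
`n + 1`) such that for every vertex `v`, every open `O ⊆ Sᵏ × Sᵏ` contained in the tube `N` on
which `ρ̂ᵥ < ε`, and the piece map `Φ : O → {ρ < ε}`, `Φ x = ι v x`, one has
`Φ₊ (μ₀|O)ₓ = ν_{Φ x}`: all eight pieces are read in ONE oriented copy of `Sᵏ × Sᵏ`. Proof: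
`{ρ < ε}` is simply connected (`simplyConnectedSpace_rho_lt`), hence oriented by some `ν`
(Hatcher Prop. 3.25); pulling `ν` back along the `v`-th piece map gives `±μ|{ρ̂ᵥ < ε}` for a
fixed orientation `μ` of `Sᵏ × Sᵏ` (the piece `{ρ̂ᵥ < ε}` is connected); the signs of two
adjacent pieces agree because at the crossing point `(e, e)` the two piece maps differ by the
plumbing map, which preserves `μ_{(e,e)}` for `k` even
(`map_plumbMap_openSubsetIso_inv_localClass`); the `E₈` tree being connected, all eight signs
agree, and `μ₀ = ±μ` accordingly. [cite: Kosinski1993, VI.12 p. 120 and (12.4)] [cite: HatcherAT2002, Prop. 3.25, §3.3 pp. 231–236] -/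
theorem exists_orientation_rho_lt (hke : Even k) (hε : 0 < ε) :
    ∃ (μ₀ : HomologicalOrientation ℤ ((Metric.sphere (0 : EuclideanSpace ℝ (Fin (k + 1))) 1) ×
        (Metric.sphere (0 : EuclideanSpace ℝ (Fin (k + 1))) 1)) (n + 1))
      (ν : HomologicalOrientation ℤ ↥{p : PV k c hk hc hkn | rho hk hc hkn p < ε} (n + 1)),
      ∀ (v : Fin 8) (O : Opens ((Metric.sphere (0 : EuclideanSpace ℝ (Fin (k + 1))) 1) ×
          (Metric.sphere (0 : EuclideanSpace ℝ (Fin (k + 1))) 1)))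
        (hO : ∀ x ∈ O, c < fibHt x ∧ rhoHat k c v x < ε)
        (Φ : C(↥O, ↥{p : PV k c hk hc hkn | rho hk hc hkn p < ε}))
        (hΦ : ∀ x : ↥O, (Φ x).1 = ι hk hc hkn v ⟨x.1, (hO x.1 x.2).1⟩)
        (x : ↥O) (q : ↥{p : PV k c hk hc hkn | rho hk hc hkn p < ε}) (hq : Φ x = q)
        (h : MapsTo Φ ({x}ᶜ : Set ↥O) ({q}ᶜ : Set _)),
        relativeSingularHomology.map ℤ ℤ Φ h (n + 1)
            ((localHomology.openSubsetIso ℤ ℤ O.2 x.2 (n + 1)).inv (μ₀.localClass x.1)) =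
          ν.localClass q := by
  classical
  -- the interior `Xs = {ρ < ε}` as an open submanifold, simply connected, oriented by `ν`
  set Xs : Set (PV k c hk hc hkn) := {p | rho hk hc hkn p < ε} with hXs
  have hXo : IsOpen Xs := isOpen_lt (continuous_rho hk hc hkn) continuous_const
  letI : ChartedSpace (EuclideanSpace ℝ (Fin (n + 1))) ↥Xs :=
    inferInstanceAs (ChartedSpace (EuclideanSpace ℝ (Fin (n + 1))) (⟨Xs, hXo⟩ : Opens (PV k c hk hc hkn)))
  haveI : SimplyConnectedSpace ↥Xs := simplyConnectedSpace_rho_lt hk hc hkn hε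
  obtain ⟨ν⟩ := isOrientableOver_of_simplyConnectedSpace ℤ ↥Xs (n := n + 1)
  -- a reference orientation `μ` of `Sᵏ × Sᵏ`
  obtain ⟨μ⟩ := SphereProd.isOrientableOver' hkn hk
  letI : ChartedSpace (EuclideanSpace ℝ (Fin (n + 1)))
      ((Metric.sphere (0 : EuclideanSpace ℝ (Fin (k + 1))) 1) ×
        (Metric.sphere (0 : EuclideanSpace ℝ (Fin (k + 1))) 1)) := SphereProd.chartedSpace' hkn
  -- the pieces `P v = {c < ⟪p,q⟫, ρ̂ᵥ < ε}` as opens of `Sᵏ × Sᵏ`, and the piece maps `Ψ v`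
  have hPo : ∀ v : Fin 8, IsOpen {x : (Metric.sphere (0 : EuclideanSpace ℝ (Fin (k + 1))) 1) ×
      (Metric.sphere (0 : EuclideanSpace ℝ (Fin (k + 1))) 1) | c < fibHt x ∧ rhoHat k c v x < ε} := by
    intro v
    have h1 : IsOpen (Subtype.val '' pieceT k c v ε : Set ((Metric.sphere (0 : EuclideanSpace ℝ (Fin (k + 1))) 1) ×
        (Metric.sphere (0 : EuclideanSpace ℝ (Fin (k + 1))) 1))) :=
      (Tb k c).2.isOpenMap_subtype_val _ (isOpen_pieceT hc v ε)
    convert h1 using 1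
    ext x
    constructor
    · rintro ⟨h1, h2⟩; exact ⟨⟨x, h1⟩, h2, rfl⟩
    · rintro ⟨y, hy, rfl⟩; exact ⟨y.2, hy⟩
  set P : Fin 8 → Opens ((Metric.sphere (0 : EuclideanSpace ℝ (Fin (k + 1))) 1) ×
      (Metric.sphere (0 : EuclideanSpace ℝ (Fin (k + 1))) 1)) := fun v => ⟨_, hPo v⟩ with hP
  have hPO : ∀ (v : Fin 8), ∀ x ∈ P v, c < fibHt x ∧ rhoHat k c v x < ε := fun v x hx => hx
  have hΨemb : ∀ v : Fin 8, IsOpenEmbedding fun x : ↥(P v) =>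
      (⟨ι hk hc hkn v ⟨x.1, (hPO v x.1 x.2).1⟩, pieceMap_mem hk hc hkn v x.1 (hPO v x.1 x.2)⟩ : ↥Xs) :=
    fun v => isOpenEmbedding_pieceMap hk hc hkn v (P v) (hPO v)
  set Ψ : ∀ v : Fin 8, C(↥(P v), ↥Xs) := fun v =>
    ⟨fun x => ⟨ι hk hc hkn v ⟨x.1, (hPO v x.1 x.2).1⟩, pieceMap_mem hk hc hkn v x.1 (hPO v x.1 x.2)⟩,
      (hΨemb v).continuous⟩ with hΨ
  -- pull `ν` back along the piece maps
  have hκex : ∀ v : Fin 8, ∃ κ : HomologicalOrientation ℤ ↥(P v) (n + 1), ∀ y : ↥(P v),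
      relativeSingularHomology.map ℤ ℤ (Ψ v) (LocalFamily.mapsTo_compl_pt (hΨemb v).injective y) (n + 1)
        (κ.localClass y) = ν.localClass (Ψ v y) :=
    fun v => HomologicalOrientation.exists_map_localClass_eq_of_isOpenEmbedding ν (Ψ v) (hΨemb v)
  choose κ hκ using hκex
  have hκ' : ∀ (v : Fin 8) (y : ↥(P v)) (q : ↥Xs) (hq : Ψ v y = q)
      (h : MapsTo (Ψ v) ({y}ᶜ : Set _) ({q}ᶜ : Set _)),
      relativeSingularHomology.map ℤ ℤ (Ψ v) h (n + 1) ((κ v).localClass y) = ν.localClass q := by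
    intro v y q hq h; subst hq; exact hκ v y
  -- each pull-back is `±μ|P v` (the pieces are connected)
  have hconn : ∀ v : Fin 8, ConnectedSpace ↥(P v) := by
    intro v
    have hpc := (isPathConnected_pieceT hk hc v hε).image' continuous_subtype_val.continuousOn
    have heq : (Subtype.val '' pieceT k c v ε : Set _) = (P v : Set _) := by
      ext x
      constructor
      · rintro ⟨y, hy, rfl⟩; exact ⟨y.2, hy⟩
      · rintro ⟨h1, h2⟩; exact ⟨⟨x, h1⟩, h2, rfl⟩
    rw [heq] at hpc
    haveI := isPathConnected_iff_pathConnectedSpace.1 hpc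
    infer_instance
  have hsgn : ∀ v : Fin 8, κ v = μ.restrictOpens (P v) ∨ κ v = -(μ.restrictOpens (P v)) := by
    intro v
    haveI := hconn v
    exact HomologicalOrientation.eq_or_eq_neg_of_connected_holds _ (κ v) (μ.restrictOpens (P v))
  -- ### the edge step: adjacent pieces have the same sign
  have hedge : ∀ v w : Fin 8, kosinskiGamma8 v w = 1 →
      (κ v = μ.restrictOpens (P v) ↔ κ w = μ.restrictOpens (P w)) := by
    intro v w hvw
    -- the crossing point
    set j : Fin 3 := ecol v w with hj
    set e : Metric.sphere (0 : EuclideanSpace ℝ (Fin (k + 1))) 1 := pole k j.val with he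
    set x₀ : (Metric.sphere (0 : EuclideanSpace ℝ (Fin (k + 1))) 1) ×
      (Metric.sphere (0 : EuclideanSpace ℝ (Fin (k + 1))) 1) := (e, e) with hx₀
    have hfib : c < fibHt x₀ := by
      change c < ⟪(e : EuclideanSpace ℝ (Fin (k + 1))), (e : EuclideanSpace ℝ (Fin (k + 1)))⟫
      rw [real_inner_self_eq_norm_sq, norm_eq_of_mem_sphere e, one_pow]; exact hc.lt_one
    have hx₀v : x₀ ∈ P v := ⟨hfib, lt_of_le_of_lt (rhoHat_diagPt_le hc v e) hε⟩
    have hx₀w : x₀ ∈ P w := ⟨hfib, lt_of_le_of_lt (rhoHat_diagPt_le hc w e) hε⟩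
    have hx₀D : x₀ ∈ dom k c j := diag_pole_mem_plumbDom e hc.lt_one
    have hPx₀ : plumbMap e x₀ = x₀ := plumbMap_diag_pole e
    -- the common image point `X₀`
    set X₀ : ↥Xs := Ψ v ⟨x₀, hx₀v⟩ with hX₀
    have hpm₀ : pm hc j ⟨x₀, hfib⟩ = ⟨x₀, hfib⟩ := by
      apply Subtype.ext; rw [coe_pm_of_mem hc (x := ⟨x₀, hfib⟩) hx₀D]; exact hPx₀
    have hX₀w : Ψ w ⟨x₀, hx₀w⟩ = X₀ := by
      apply Subtype.ext
      change ι hk hc hkn w ⟨x₀, hfib⟩ = ι hk hc hkn v ⟨x₀, hfib⟩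
      rw [← ι_pm hk hc hkn v w hvw (x := ⟨x₀, hfib⟩) hx₀D, hpm₀]
    -- the open set `D₂ = D_j ∩ P v ∩ plumbMap⁻¹ (P w)` and the maps `D₂ → P v`, `D₂ → P w`
    set D₂ : Set ((Metric.sphere (0 : EuclideanSpace ℝ (Fin (k + 1))) 1) ×
      (Metric.sphere (0 : EuclideanSpace ℝ (Fin (k + 1))) 1)) :=
      {x | x ∈ dom k c j ∧ x ∈ P v ∧ plumbMap e x ∈ P w} with hD₂
    have hDdom : dom k c j ⊆ plumbDom e (-1) := fun x hx =>
      ⟨lt_of_le_of_lt hc.neg_one_le hx.1, lt_of_le_of_lt hc.neg_one_le hx.2⟩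
    have hPc : ContinuousOn (plumbMap e) (dom k c j) := (continuousOn_plumbMap e).mono hDdom
    have hD₂o : IsOpen D₂ := by
      have h1 : IsOpen (dom k c j ∩ plumbMap e ⁻¹' (P w : Set _)) :=
        hPc.isOpen_inter_preimage (isOpen_dom c j) (P w).2
      have : D₂ = (dom k c j ∩ plumbMap e ⁻¹' (P w : Set _)) ∩ (P v : Set _) := by
        ext x; simp only [hD₂, mem_setOf_eq, mem_inter_iff, mem_preimage, SetLike.mem_coe]; tauto
      rw [this]; exact h1.inter (P v).2
    have hx₀D₂ : x₀ ∈ D₂ := ⟨hx₀D, hx₀v, by rw [hPx₀]; exact hx₀w⟩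
    set D₂ₒ : Opens ((Metric.sphere (0 : EuclideanSpace ℝ (Fin (k + 1))) 1) ×
      (Metric.sphere (0 : EuclideanSpace ℝ (Fin (k + 1))) 1)) := ⟨D₂, hD₂o⟩ with hD₂ₒ
    have hD₂v : (D₂ₒ : Set ((Metric.sphere (0 : EuclideanSpace ℝ (Fin (k + 1))) 1) × (Metric.sphere (0 : EuclideanSpace ℝ (Fin (k + 1))) 1))) ⊆
        (P v : Set ((Metric.sphere (0 : EuclideanSpace ℝ (Fin (k + 1))) 1) × (Metric.sphere (0 : EuclideanSpace ℝ (Fin (k + 1))) 1))) := fun x hx => hx.2.1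
    set inclV : C(↥D₂ₒ, ↥(P v)) := ⟨fun z => ⟨z.1, hD₂v z.2⟩, by fun_prop⟩ with hinclV
    have hPDc : Continuous fun z : ↥D₂ₒ => (⟨plumbMap e z.1, z.2.2.2⟩ : ↥(P w)) :=
      (hPc.comp_continuous continuous_subtype_val fun z => z.2.1).subtype_mk _
    set PD : C(↥D₂ₒ, ↥(P w)) := ⟨fun z => ⟨plumbMap e z.1, z.2.2.2⟩, hPDc⟩ with hPD
    -- `MapsTo` data
    have hPDinj : Injective PD := by
      intro a b hab
      apply Subtype.ext
      have h1 : plumbMap e a.1 = plumbMap e b.1 := congrArg Subtype.val hab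
      have h2 := congrArg (plumbMap e) h1
      rwa [plumbMap_plumbMap, plumbMap_plumbMap] at h2
    have mV : MapsTo inclV ({(⟨x₀, hx₀D₂⟩ : ↥D₂ₒ)}ᶜ : Set _) ({(⟨x₀, hx₀v⟩ : ↥(P v))}ᶜ : Set _) :=
      AlgebraicTopology.SingularHomology.mapsTo_compl_singleton_of_injective (f := inclV)
        (fun a b hab => by
          apply Subtype.ext
          have h1 := congrArg Subtype.val hab
          exact h1) rfl
    have mPD : MapsTo PD ({(⟨x₀, hx₀D₂⟩ : ↥D₂ₒ)}ᶜ : Set _) ({(⟨x₀, hx₀w⟩ : ↥(P w))}ᶜ : Set _) :=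
      AlgebraicTopology.SingularHomology.mapsTo_compl_singleton_of_injective
        hPDinj (Subtype.ext hPx₀)
    have mΨv : MapsTo (Ψ v) ({(⟨x₀, hx₀v⟩ : ↥(P v))}ᶜ : Set _) ({X₀}ᶜ : Set _) :=
      AlgebraicTopology.SingularHomology.mapsTo_compl_singleton_of_injective (hΨemb v).injective rfl
    have mΨw : MapsTo (Ψ w) ({(⟨x₀, hx₀w⟩ : ↥(P w))}ᶜ : Set _) ({X₀}ᶜ : Set _) :=
      AlgebraicTopology.SingularHomology.mapsTo_compl_singleton_of_injective
        (hΨemb w).injective hX₀w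
    -- (a) `inclV₊ (μ|D₂)_{x₀} = (μ|P v)_{x₀}`
    have ha : relativeSingularHomology.map ℤ ℤ inclV mV (n + 1) ((μ.restrictOpens D₂ₒ).localClass ⟨x₀, hx₀D₂⟩) =
        (μ.restrictOpens (P v)).localClass ⟨x₀, hx₀v⟩ :=
      HomologicalOrientation.map_inclusion_restrictOpens_localClass μ hD₂v ⟨x₀, hx₀D₂⟩ mV
    -- (b) `PD₊ (μ|D₂)_{x₀} = (μ|P w)_{x₀}`: through the full plumbing domain and `PlumbingMapOrientation`
    have hb : relativeSingularHomology.map ℤ ℤ PD mPD (n + 1) ((μ.restrictOpens D₂ₒ).localClass ⟨x₀, hx₀D₂⟩) =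
        (μ.restrictOpens (P w)).localClass ⟨x₀, hx₀w⟩ := by
      have mvalw : MapsTo (HomologicalOrientation.valC (P w)) ({(⟨x₀, hx₀w⟩ : ↥(P w))}ᶜ : Set _)
          ({x₀}ᶜ : Set _) := LocalFamily.mapsTo_compl_pt Subtype.val_injective _
      apply map_valC_localHomology_injective (P w) ⟨x₀, hx₀w⟩ rfl mvalw
      rw [HomologicalOrientation.map_val_restrictOpens_localClass, ← ModuleCat.comp_apply,
        ← relativeSingularHomology.map_comp,
        HomologicalOrientation.restrictOpens_localClass_eq_openSubsetIso_inv μ D₂ₒ ⟨x₀, hx₀D₂⟩]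
      -- factor `val ∘ PD = Pfull ∘ incl` through the full plumbing domain `dom k c j`
      have hPfc : Continuous fun z : ↥(dom k c j) => plumbMap e z.1 :=
        hPc.comp_continuous continuous_subtype_val fun z => z.2
      set Pfull : C(↥(dom k c j), (Metric.sphere (0 : EuclideanSpace ℝ (Fin (k + 1))) 1) ×
        (Metric.sphere (0 : EuclideanSpace ℝ (Fin (k + 1))) 1)) := ⟨fun z => plumbMap e z.1, hPfc⟩ with hPfull
      have hD₂dom : D₂ ⊆ dom k c j := fun x hx => hx.1
      have mfull : MapsTo Pfull ({(⟨x₀, hx₀D⟩ : ↥(dom k c j))}ᶜ : Set _) ({x₀}ᶜ : Set _) :=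
        AlgebraicTopology.SingularHomology.mapsTo_compl_singleton_of_injective
          (f := Pfull) (fun a b hab => Subtype.ext (by
          change plumbMap e a.1 = plumbMap e b.1 at hab
          have h2 := congrArg (plumbMap e) hab
          rwa [plumbMap_plumbMap, plumbMap_plumbMap] at h2)) hPx₀
      have mincl : MapsTo (⟨Set.inclusion hD₂dom, continuous_inclusion hD₂dom⟩ : C(↥D₂, ↥(dom k c j)))
          ({(⟨x₀, hx₀D₂⟩ : ↥D₂)}ᶜ : Set _) ({(⟨x₀, hx₀D⟩ : ↥(dom k c j))}ᶜ : Set _) :=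
        AlgebraicTopology.SingularHomology.mapsTo_compl_singleton_of_injective
          (Set.inclusion_injective hD₂dom) rfl
      have hfac : (HomologicalOrientation.valC (P w)).comp PD =
          Pfull.comp ⟨Set.inclusion hD₂dom, continuous_inclusion hD₂dom⟩ := by
        ext z : 1; rfl
      rw [relativeSingularHomology.map_congr ℤ ℤ hfac (mvalw.comp mPD) (mfull.comp mincl) (n + 1),
        relativeSingularHomology.map_comp ℤ ℤ _ Pfull mincl mfull (n + 1), ModuleCat.comp_apply]
      erw [map_inclusion_openSubsetIso_inv hD₂o (isOpen_dom c j) hD₂dom hx₀D₂ (μ.localClass x₀) mincl]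
      exact map_plumbMap_openSubsetIso_inv_localClass hk hke hkn μ e hc.neg_one_le hc.lt_one Pfull
        (fun z => rfl) mfull
    -- (c) `Ψ v ∘ inclV = Ψ w ∘ PD` (the identification rule of the plumbing)
    have hc' : (Ψ v).comp inclV = (Ψ w).comp PD := by
      ext z : 1
      apply Subtype.ext
      change ι hk hc hkn v ⟨z.1, _⟩ = ι hk hc hkn w ⟨plumbMap e z.1, _⟩
      have hzD : ((⟨z.1, z.2.2.1.1⟩ : Tb k c) : _ × _) ∈ dom k c (ecol v w) := z.2.1
      rw [← ι_pm hk hc hkn v w hvw hzD]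
      congr 1
      apply Subtype.ext
      rw [coe_pm_of_mem hc hzD]
    -- hence `T_v = T_w` for the pushed reference classes
    have hT : relativeSingularHomology.map ℤ ℤ (Ψ v) mΨv (n + 1) ((μ.restrictOpens (P v)).localClass ⟨x₀, hx₀v⟩) =
        relativeSingularHomology.map ℤ ℤ (Ψ w) mΨw (n + 1) ((μ.restrictOpens (P w)).localClass ⟨x₀, hx₀w⟩) := by
      rw [← ha, ← hb, ← ModuleCat.comp_apply, ← relativeSingularHomology.map_comp,
        ← ModuleCat.comp_apply, ← relativeSingularHomology.map_comp]
      rw [relativeSingularHomology.map_congr ℤ ℤ hc' (mΨv.comp mV) (mΨw.comp mPD) (n + 1)]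
    -- the two readings of `ν_{X₀}`
    have hνv : ν.localClass X₀ = relativeSingularHomology.map ℤ ℤ (Ψ v) mΨv (n + 1) ((κ v).localClass ⟨x₀, hx₀v⟩) :=
      (hκ' v ⟨x₀, hx₀v⟩ X₀ rfl mΨv).symm
    have hνw : ν.localClass X₀ = relativeSingularHomology.map ℤ ℤ (Ψ w) mΨw (n + 1) ((κ w).localClass ⟨x₀, hx₀w⟩) :=
      (hκ' w ⟨x₀, hx₀w⟩ X₀ hX₀w mΨw).symm
    have hne := ν.localClass_ne_neg X₀
    constructor
    · intro hv'
      rcases hsgn w with hw' | hw'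
      · exact hw'
      · exfalso
        apply hne
        rw [hv'] at hνv
        rw [hw', HomologicalOrientation.neg_localClass, map_neg, ← hT, ← hνv] at hνw
        exact hνw
    · intro hw'
      rcases hsgn v with hv' | hv'
      · exact hv'
      · exfalso
        apply hne
        rw [hw'] at hνw
        rw [hv', HomologicalOrientation.neg_localClass, map_neg, hT, ← hνw] at hνv
        exact hνv
  -- ### propagation along the (connected) `E₈` tree: all signs agree with that of `Σ₁`
  have hall : ∀ v : Fin 8, (κ v = μ.restrictOpens (P v) ↔ κ 0 = μ.restrictOpens (P 0)) := by
    have e01 := hedge 1 0 (by decide)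
    have e12 := hedge 2 1 (by decide)
    have e23 := hedge 3 2 (by decide)
    have e34 := hedge 4 3 (by decide)
    have e45 := hedge 5 4 (by decide)
    have e56 := hedge 6 5 (by decide)
    have e74 := hedge 7 4 (by decide)
    intro v
    fin_cases v
    · exact Iff.rfl
    · exact e01
    · exact e12.trans e01
    · exact e23.trans (e12.trans e01)
    · exact e34.trans (e23.trans (e12.trans e01))
    · exact e45.trans (e34.trans (e23.trans (e12.trans e01)))
    · exact e56.trans (e45.trans (e34.trans (e23.trans (e12.trans e01))))
    · exact e74.trans (e34.trans (e23.trans (e12.trans e01)))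
  -- ### the coherent orientation `μ₀ = ±μ`
  obtain ⟨μ₀, hμ₀⟩ : ∃ μ₀ : HomologicalOrientation ℤ ((Metric.sphere (0 : EuclideanSpace ℝ (Fin (k + 1))) 1) ×
      (Metric.sphere (0 : EuclideanSpace ℝ (Fin (k + 1))) 1)) (n + 1), ∀ v, κ v = μ₀.restrictOpens (P v) := by
    by_cases h0 : κ 0 = μ.restrictOpens (P 0)
    · exact ⟨μ, fun v => (hall v).2 h0⟩
    · refine ⟨-μ, fun v => ?_⟩
      rw [HomologicalOrientation.restrictOpens_neg]
      rcases hsgn v with hv | hv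
      · exact absurd ((hall v).1 hv) h0
      · exact hv
  -- ### conclusion for an arbitrary open `O` inside the `v`-th piece
  refine ⟨μ₀, ν, fun v O hO Φ hΦ x q hq h => ?_⟩
  have hOP : (O : Set ((Metric.sphere (0 : EuclideanSpace ℝ (Fin (k + 1))) 1) × (Metric.sphere (0 : EuclideanSpace ℝ (Fin (k + 1))) 1))) ⊆ (P v : Set ((Metric.sphere (0 : EuclideanSpace ℝ (Fin (k + 1))) 1) × (Metric.sphere (0 : EuclideanSpace ℝ (Fin (k + 1))) 1))) :=
    fun y hy => hO y hy
  have hfac : Φ = (Ψ v).comp (⟨fun z : ↥O => (⟨z.1, hOP z.2⟩ : ↥(P v)), by fun_prop⟩ : C(↥O, ↥(P v))) := by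
    ext z : 1
    exact Subtype.ext (hΦ z)
  have mO : MapsTo (⟨fun z : ↥O => (⟨z.1, hOP z.2⟩ : ↥(P v)), by fun_prop⟩ : C(↥O, ↥(P v)))
      ({x}ᶜ : Set _) ({(⟨x.1, hOP x.2⟩ : ↥(P v))}ᶜ : Set _) :=
    AlgebraicTopology.SingularHomology.mapsTo_compl_singleton_of_injective
      (f := fun z : ↥O => (⟨z.1, hOP z.2⟩ : ↥(P v)))
      (fun a b hab => by
        apply Subtype.ext
        have h1 := congrArg Subtype.val hab
        exact h1) rfl
  have hq' : Ψ v ⟨x.1, hOP x.2⟩ = q := by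
    rw [← hq, hfac]; rfl
  have mΨ : MapsTo (Ψ v) ({(⟨x.1, hOP x.2⟩ : ↥(P v))}ᶜ : Set _) ({q}ᶜ : Set _) :=
    AlgebraicTopology.SingularHomology.mapsTo_compl_singleton_of_injective (hΨemb v).injective hq'
  rw [← HomologicalOrientation.restrictOpens_localClass_eq_openSubsetIso_inv μ₀ O x,
    relativeSingularHomology.map_congr ℤ ℤ hfac h (mΨ.comp mO) (n + 1),
    relativeSingularHomology.map_comp ℤ ℤ _ (Ψ v) mO mΨ (n + 1), ModuleCat.comp_apply,
    HomologicalOrientation.map_inclusion_restrictOpens_localClass μ₀ hOP x mO, ← hμ₀ v]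
  exact hκ' v _ q hq' mΨ

end Plumbing

end Literature.Topology.FourManifolds

/-!
## Part 2. The Kronecker datum of the `E₈` plumbing `M(4m)`

Topic `Literature/Topology/FourManifolds` (fact seat of
`Literature.Topology.FourManifolds.HomotopySphere.exists_intersectionForm_equivalent_e8Form`,
Kosinski's `E₈` plumbing `M(4m)`, *Differential Manifolds* (1993), VI.12, pp. 119–122). The
Kronecker form of the `E₈` table
(`HomotopySphere.exists_intersectionForm_equivalent_e8Form_of_kroneckerData`,
`HomotopySpheresE8KroneckerTable.lean`) asks, for the closed model `M̂ = W ∪ cone(∂W)` of the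
bounding manifold with a relative fundamental class `z`, for eight vertex models `(Yᵥ, πᵥ, uᵥ, Zᵥ)`,
open pieces `Uᵥ` generated by core spheres `gᵥ`, one sign `r = ±1`, and the Kronecker numbers
`⟨uᵥ, πᵥ₊ gᵥ⟩ = 2` ((12.4)), `|⟨u_w, π_w₊ gᵥ⟩| = Γ₈(v, w)` ((12.3)). This file produces exactly
this datum for the tree's compact plumbing `W = M(4m) = {ρ ≤ ε}`
(`Plumbing.Wc`, `PlumbingFunction.lean`) of the open plumbing `PV` of eight tubes of the diagonal
of `Sᵏ × Sᵏ` (`PlumbingGlue.lean`), `k = 2m` even: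

* the vertex models are the Thom spaces `N̂_{c'}` of the tube `N_{c'}`, `c' = √(1 - ε)`
  (`SphereProductThomFundamentalClass.lean`), with their Thom classes and the vertex package
  `SphereProd.Tube.exists_vertexData_sign` (`SphereProductTubeVertexData.lean`), ALL read in one
  oriented copy of `Sᵏ × Sᵏ` — the coherent orientation `μ₀` of
  `Plumbing.exists_orientation_rho_lt` (`PlumbingOrientation.lean`), which is where `k` even
  enters — so that the sign `r = ⟨g₁ ⌣ g₂, [Sᵏ × Sᵏ]_{μ₀}⟩` is the same at all eight vertices;
* the collapses `πᵥ : M̂ → N̂_{c'}` are those of `NullCobordism.exists_ambientCollapse`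
  (`ClosedModelAmbientCollapse.lean`) for the open embeddings
  `Eᵥ : N_{c'}° ≅ {⟪p, q⟫ > c'} → {ρ < ε} = int W → M̂` (`ι v`; `ρ ≤ 1 - ⟪p, q⟫² < ε` there), and
  they carry `ẑ` to the closed-model classes of the tubes (transfer of local classes through
  `μ₀`, `ν`);
* the pieces `Uᵥ = Eᵥ(N_{c'}°)` are generated by the core spheres
  (`SphereProductOpenTubeHomology.lean`), and the identities behind (12.3)–(12.4) are POINTWISE:
  `πᵥ ∘ Eᵥ ∘ diag = (Thom collapse) ∘ diag`, and for an edge `{v, w}` of colour `e`,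
  `π_w ∘ Eᵥ ∘ diag = (Thom collapse) ∘ (x ↦ (e, x))` on ALL of `Sᵏ` (the plumbing identifies the
  core point `(x, x)` of the `v`-th tube with the fibre point `(e, x)` of the `w`-th tube when
  `⟪x, e⟫ > c`, and both sides are `∞` otherwise), while for a non-edge `π_w ∘ Eᵥ ∘ diag ≡ ∞`.

* **`Plumbing.exists_kroneckerData`** — the relative fundamental class `z` of `M(4m)` and the
  Kronecker datum, in the exact shape consumed by `…_of_kroneckerData`.

Everything is proved; no definitions, no named facts (D-0026).

## References

* A. Kosinski, *Differential Manifolds*, Academic Press 1993, VI.12 pp. 119–122, (12.2)–(12.4).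
  [Kosinski1993]
* J. Milnor, J. Stasheff, *Characteristic classes*, Princeton 1974, §11 Thm. 11.1, Cor. 11.2,
  §18 p. 205. [MilnorStasheff1974]
* A. Hatcher, *Algebraic Topology*, CUP 2002, §3.3 Thm. 3.26, p. 241, Lemma 3.27, p. 253.
  [HatcherAT2002]
* M. Kervaire, J. Milnor, *Groups of homotopy spheres: I*, Ann. of Math. 77 (1963), §7
  footnote pp. 528–529. [KervaireMilnorAnnals1963]
-/

open scoped Manifold ContDiff Topology RealInnerProductSpace
open Set Function CategoryTheory CategoryTheory.Limits Topology TopologicalSpace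


namespace Literature.Topology.FourManifolds

open Literature.AlgebraicTopology.SingularHomology Literature.Geometry.Manifold

/-! ### Auxiliary lemmas -/

section Aux

/-- A constant map kills `Hⱼ` for `j ≥ 1` (it factors through a point; Hatcher Prop. 2.8).
[cite: HatcherAT2002, Prop. 2.8] -/
theorem singularHomology_map_const_eq_zero {X Y : Type} [TopologicalSpace X] [TopologicalSpace Y]
    (y : Y) {j : ℕ} (hj : j ≠ 0) :
    singularHomology.map ℤ ℤ (ContinuousMap.const X y) j = 0 := by
  have hfac : ContinuousMap.const X y =
      (ContinuousMap.const PUnit.{1} y).comp (ContinuousMap.const X PUnit.unit) := rfl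
  rw [hfac, singularHomology.map_comp]
  have h0 : IsZero (singularHomology ℤ ℤ PUnit.{1} j) :=
    isZero_singularHomology_of_subsingleton ℤ ℤ (X := PUnit.{1}) hj
  rw [h0.eq_of_src (singularHomology.map ℤ ℤ (ContinuousMap.const PUnit.{1} y) j) 0, comp_zero]

/-- Three-fold functoriality of the push-forward on local homology, for a map given as a
composite `F = h ∘ g ∘ f` (bookkeeping lemma). [folklore] -/
theorem relativeSingularHomology_map_map_map_eq {A B C D : Type} [TopologicalSpace A] [TopologicalSpace B]
    [TopologicalSpace C] [TopologicalSpace D] (f : C(A, B)) (g : C(B, C)) (h : C(C, D)) (F : C(A, D))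
    (hF : F = h.comp (g.comp f)) {a : A} {b : B} {c : C} {d : D}
    (hf : MapsTo f ({a}ᶜ : Set A) ({b}ᶜ : Set B)) (hg : MapsTo g ({b}ᶜ : Set B) ({c}ᶜ : Set C))
    (hh : MapsTo h ({c}ᶜ : Set C) ({d}ᶜ : Set D)) (hF' : MapsTo F ({a}ᶜ : Set A) ({d}ᶜ : Set D))
    (n : ℕ) (x : localHomology ℤ ℤ A a n) :
    relativeSingularHomology.map ℤ ℤ h hh n
        (relativeSingularHomology.map ℤ ℤ g hg n (relativeSingularHomology.map ℤ ℤ f hf n x)) =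
      relativeSingularHomology.map ℤ ℤ F hF' n x := by
  subst hF
  rw [← ModuleCat.comp_apply, ← ModuleCat.comp_apply, ← relativeSingularHomology.map_comp,
    ← relativeSingularHomology.map_comp]
  rfl

end Aux

namespace NullCobordism

variable {m : ℕ} {MP : Type} [TopologicalSpace MP] [ChartedSpace (EuclideanSpace ℝ (Fin (m + 1))) MP]
  [IsManifold (𝓡 (m + 1)) ∞ MP] [CompactSpace MP] [Nonempty MP]

omit [IsManifold (𝓡 (m + 1)) ∞ MP] [CompactSpace MP] [Nonempty MP] in
/-- **The local classes of the closed-model class `ẑ_w` at the finite points, for a relative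
fundamental class `w` integrated from an orientation `ν` of the interior** (the identity behind
`exists_collapse_fundamentalClass`, isolated): `ẑ_w|_{y} = F₊ ν_y` for any `F : int W → Ŵ` which
is pointwise the inclusion of the interior. [cite: HatcherAT2002, §3.3 p. 253 and Lemma 3.27] -/
theorem toLocal_closedModelClass_eq_map_of_interiorOrientation (cP : NullCobordism (m + 1) MP)
    (ν : HomologicalOrientation ℤ cP.Interior (m + 1 + 1))
    (w : relativeSingularHomology ℤ ℤ cP.W ((𝓡∂ (m + 1 + 1)).boundary cP.W) (m + 1 + 1))
    (hwloc : ∀ v : cP.Interior,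
      relativeSingularHomology.toLocal ℤ ℤ ((𝓡∂ (m + 1 + 1)).boundary cP.W)
          ⟨v.val, cP.val_mem_compl_boundary v⟩ (m + 1 + 1) w =
        relativeSingularHomology.map ℤ ℤ cP.valCM (cP.mapsTo_val_compl_singleton v) (m + 1 + 1)
          (ν.localClass v))
    (F : C(cP.Interior, ClosedModel (m + 1) cP.W))
    (hF : ∀ v, F v = ClosedModel.ofInterior (⟨v.val, v.property⟩ : ManifoldInterior (m + 1) cP.W))
    (y : ManifoldInterior (m + 1) cP.W)
    (h : MapsTo F ({(⟨y.1, y.2⟩ : cP.Interior)}ᶜ : Set _) ({ClosedModel.ofInterior y}ᶜ : Set _)) :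
    singularHomology.toLocal ℤ ℤ (ClosedModel.ofInterior y) (m + 1 + 1)
        (cP.closedModelClass ℤ ℤ (Nat.le_add_left 1 m) w) =
      relativeSingularHomology.map ℤ ℤ F h (m + 1 + 1) (ν.localClass ⟨y.1, y.2⟩) := by
  have hyint : (y.1 : cP.W) ∈ (𝓡∂ (m + 1 + 1)).interior cP.W := y.2
  have e2 : boundaryCollapse (m + 1) cP.W y.1 = ClosedModel.ofInterior y := by
    rw [boundaryCollapse_of_mem_interior hyint]; rfl
  have hfp : MapsTo ((boundaryCollapse (m + 1) cP.W).comp cP.valCM)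
      ({(⟨y.1, y.2⟩ : cP.Interior)}ᶜ : Set _) ({boundaryCollapse (m + 1) cP.W y.1}ᶜ : Set _) :=
    (cP.mapsTo_boundaryCollapse_compl_singleton hyint).comp
      (cP.mapsTo_val_compl_singleton ⟨y.1, y.2⟩)
  have hfq : MapsTo ((boundaryCollapse (m + 1) cP.W).comp cP.valCM)
      ({(⟨y.1, y.2⟩ : cP.Interior)}ᶜ : Set _) ({ClosedModel.ofInterior y}ᶜ : Set _) := by
    rw [← e2]; exact hfp
  have s1 := cP.toLocal_closedModelClass_of_mem_interior ℤ ℤ (Nat.le_add_left 1 m) w hyint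
  have s2 := hwloc ⟨y.1, y.2⟩
  have s3 : singularHomology.toLocal ℤ ℤ (boundaryCollapse (m + 1) cP.W y.1)
      (m + 1 + 1) (cP.closedModelClass ℤ ℤ (Nat.le_add_left 1 m) w) =
      relativeSingularHomology.map ℤ ℤ ((boundaryCollapse (m + 1) cP.W).comp cP.valCM) hfp
        (m + 1 + 1) (ν.localClass ⟨y.1, y.2⟩) := by
    rw [s1]
    erw [s2]
    exact (ConcreteCategory.congr_hom (relativeSingularHomology.map_comp ℤ ℤ cP.valCM
      (boundaryCollapse (m + 1) cP.W) (cP.mapsTo_val_compl_singleton ⟨y.1, y.2⟩)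
      (cP.mapsTo_boundaryCollapse_compl_singleton hyint) (m + 1 + 1)) (ν.localClass ⟨y.1, y.2⟩)).symm
  have s4 := (singularHomology.toLocal_eq_map_iff_of_eq e2 (m + 1 + 1) _ _ hfp hfq
    (ν.localClass ⟨y.1, y.2⟩)).1 s3
  have hfg : (boundaryCollapse (m + 1) cP.W).comp cP.valCM = F := by
    ext v' : 1
    rw [ContinuousMap.comp_apply, hF v']
    exact boundaryCollapse_of_mem_interior v'.property
  rw [s4]
  exact ConcreteCategory.congr_hom (relativeSingularHomology.map_congr_fun' (R := ℤ) hfg hfq h (m + 1 + 1)) _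

end NullCobordism


namespace Plumbing

variable {k : ℕ}

/-- On the diagonal the plumbing map is `(x, x) ↦ (e, x)` (where `⟪x, e⟫ > -1`): the core point
of one tube is the fibre point over the pole of the other (Kosinski VI.12 p. 120: the presentation
sphere of one handle meets the other handle in a fibre disc). (Local copy of the tree's
`Plumbing.plumbMap_diag` of `PlumbingCollapse.lean`, kept private to avoid the import.)
[cite: Kosinski1993, VI.12 p. 120 and (12.3)] -/
private theorem plumbMap_diag' (e x : Metric.sphere (0 : EuclideanSpace ℝ (Fin (k + 1))) 1)
    (h : -1 < ⟪(x : EuclideanSpace ℝ (Fin (k + 1))), (e : EuclideanSpace ℝ (Fin (k + 1)))⟫) :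
    plumbMap e (x, x) = (e, x) := by
  have hpe : ‖(x : EuclideanSpace ℝ (Fin (k + 1)))‖ = ‖(e : EuclideanSpace ℝ (Fin (k + 1)))‖ := by
    rw [norm_eq_of_mem_sphere x, norm_eq_of_mem_sphere e]
  have h0 := add_ne_zero_of_neg_one_lt_inner (norm_eq_of_mem_sphere e) h
  have h1 : plumbFst e (x, x) = e := Subtype.ext (rotTo_self hpe h0)
  refine Prod.ext h1 (Subtype.ext ?_)
  rw [plumbMap_snd, coe_plumbSnd, h1]
  change rotFrom (e : EuclideanSpace ℝ (Fin (k + 1))) (e : EuclideanSpace ℝ (Fin (k + 1)))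
    (x : EuclideanSpace ℝ (Fin (k + 1))) = x
  conv_lhs => rw [← rotTo_self_self (p := (e : EuclideanSpace ℝ (Fin (k + 1)))) (x : EuclideanSpace ℝ (Fin (k + 1)))]
  exact rotFrom_rotTo _ _ _

end Plumbing

namespace SphereProd

variable {k n : ℕ} {hkn : k + k = n + 1} {c : ℝ} (hc : |c| < 1)

/-- The point at infinity of the Thom space is not on the image of the diagonal. [folklore] -/
theorem infty_not_mem_thomDiag :
    (OnePoint.infty : ThomSp k n hkn hc) ∉ thomDiag (openTubeHomeomorph (hkn := hkn) hc) := by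
  rintro ⟨q, -, hq⟩
  exact OnePoint.coe_ne_infty _ hq

end SphereProd

/-! ### The Kronecker datum of `M(4m)` -/

namespace Plumbing

open SphereProd

variable {k n : ℕ} {c ε : ℝ} (hk : 2 ≤ k) (hke : Even k) (hc : IsParam c) (hkn : k + k = n + 1)
  (hε : 0 < ε) (hε' : ε ≤ epsMax c)

include hε in
/-- The auxiliary tube parameter `c' = √(1 - ε)`: `|c'| < 1` (`ε > 0`). [folklore] -/
theorem abs_sqrt_one_sub_lt_one : |Real.sqrt (1 - ε)| < 1 := by
  rw [abs_of_nonneg (Real.sqrt_nonneg _), Real.sqrt_lt' one_pos, one_pow]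
  linarith

include hc hε' in
/-- `c ≤ c' = √(1 - ε)` (because `ε ≤ ε₀ ≤ 1 - c²`). [folklore] -/
theorem le_sqrt_one_sub : c ≤ Real.sqrt (1 - ε) := by
  have hrs := rsq_pos hc
  rw [epsMax, rsq] at hε'
  rw [rsq] at hrs
  rw [show c = Real.sqrt (c ^ 2) by rw [Real.sqrt_sq hc.nonneg]]
  exact Real.sqrt_le_sqrt (by nlinarith)

include hc hε hε' in
/-- On the open tube `{⟪p, q⟫ > c'}`, `c' = √(1 - ε)`: `c < ⟪p, q⟫` and `ρ̂ᵥ < ε` for every `v`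
(`ρ̂ᵥ ≤ b = 1 - ⟪p, q⟫²`, `rhoHat_le_bFn`). [cite: Kosinski1993, VI.12 pp. 119–122] -/
theorem lt_fibHt_and_rhoHat_lt (v : Fin 8)
    (x : (Metric.sphere (0 : EuclideanSpace ℝ (Fin (k + 1))) 1) ×
      (Metric.sphere (0 : EuclideanSpace ℝ (Fin (k + 1))) 1))
    (hx : x ∈ openTube k (Real.sqrt (1 - ε))) : c < fibHt x ∧ rhoHat k c v x < ε := by
  have hrs := rsq_pos hc
  rw [epsMax, rsq] at hε'
  rw [rsq] at hrs
  have h1ε : 0 ≤ 1 - ε := by nlinarith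
  have hsq : Real.sqrt (1 - ε) ^ 2 = 1 - ε := Real.sq_sqrt h1ε
  have hc' : c ≤ Real.sqrt (1 - ε) := le_sqrt_one_sub hc hε'
  have hxc : Real.sqrt (1 - ε) < fibHt x := hx
  refine ⟨lt_of_le_of_lt hc' hxc, ?_⟩
  have hb : bFn x < ε := by
    rw [bFn_apply]
    have h0 : 0 ≤ Real.sqrt (1 - ε) := Real.sqrt_nonneg _
    nlinarith
  exact lt_of_le_of_lt (rhoHat_le_bFn hc v x) hb

include hke in
set_option maxHeartbeats 3200000 in
/-- **The Kronecker datum of the `E₈` plumbing `M(4m)`** (Kosinski 1993, VI.12, (12.2)–(12.4)),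
in the shape consumed by `HomotopySphere.exists_intersectionForm_equivalent_e8Form_of_kroneckerData`.
For `k ≥ 2` even, `k + k = n + 1`, an admissible `c`, `0 < ε ≤ ε₀` and any `hn : 1 ≤ n`, the
compact plumbing `W = {ρ ≤ ε}` (as the null-cobordism `Wc.nullCobordism` of its boundary) carries
a relative fundamental class `z` and: vertex models `Yᵥ = N̂_{c'}` (the Thom space of the tube
`N_{c'}`, `c' = √(1 - ε)`) with collapses `πᵥ : Ŵ → Yᵥ`, Thom classes `uᵥ` vanishing off the
image `Zᵥ` of the diagonal, open pieces `Uᵥ = Eᵥ(N_{c'}°)` generated by the core spheres `gᵥ`,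
and ONE sign `r = ±1`, such that `uᵥ ⌢ πᵥ₊ ẑ = r • πᵥ₊ gᵥ`, `⟨uᵥ, πᵥ₊ gᵥ⟩ = 2` ((12.4): the
Euler number of `TS²ᵐ`) and `|⟨u_w, π_w₊ gᵥ⟩| = Γ₈(v, w)` for `v ≠ w` ((12.3): one transverse
crossing in a plumbing square — the core of the `v`-th tube read in the `w`-th vertex model is a
fibre sphere — or none). The single sign comes from reading all eight vertex packages
(`Tube.exists_vertexData_sign`) in the coherent orientation `μ₀` of `Sᵏ × Sᵏ`
(`exists_orientation_rho_lt`, `k` even). [cite: Kosinski1993, VI.12 pp. 119–122, (12.2)–(12.4)] [cite: MilnorStasheff1974, §11 Thm. 11.1, Cor. 11.2] [cite: HatcherAT2002, §3.3 Thm. 3.26(a), p. 241, p. 253] -/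
theorem exists_kroneckerData (hn : 1 ≤ n) :
    ∃ (z : relativeSingularHomology ℤ ℤ (Wc.nullCobordism hk hc hkn hε hε').W
          ((𝓡∂ (n + 1)).boundary (Wc.nullCobordism hk hc hkn hε hε').W) (n + 1)),
      IsRelFundamentalClass ℤ ((𝓡∂ (n + 1)).boundary (Wc.nullCobordism hk hc hkn hε hε').W) z ∧
      ∃ (Y : Fin 8 → Type) (_ : ∀ v, TopologicalSpace (Y v))
        (π : ∀ v, C(ClosedModel n (Wc.nullCobordism hk hc hkn hε hε').W, Y v))
        (u : ∀ v, singularCohomology ℤ ℤ (Y v) k) (Z : ∀ v, Set (Y v))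
        (U : Fin 8 → Set (ClosedModel n (Wc.nullCobordism hk hc hkn hε hε').W))
        (g : ∀ v, singularHomology ℤ ℤ ↥(U v) k) (r : ℤ),
        (r = 1 ∨ r = -1) ∧
        (∀ v, singularCohomology.map ℤ ℤ (subsetIncl (Z v)ᶜ) k (u v) = 0) ∧
        (∀ v, IsOpen (U v)) ∧ (∀ v, IsClosed ((π v) ⁻¹' Z v)) ∧ (∀ v, (π v) ⁻¹' Z v ⊆ U v) ∧
        (∀ v (y : singularHomology ℤ ℤ ↥(U v) k), ∃ a : ℤ, y = a • g v) ∧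
        (∀ v (a : ℤ), a • singularHomology.map ℤ ℤ (π v) k
          (singularHomology.map ℤ ℤ (subsetIncl (U v)) k (g v)) = 0 → a = 0) ∧
        (∀ v, capProduct hkn (u v)
            (singularHomology.map ℤ ℤ (π v) (n + 1)
              ((Wc.nullCobordism hk hc hkn hε hε').closedModelClass ℤ ℤ hn z)) =
          r • singularHomology.map ℤ ℤ (π v) k
            (singularHomology.map ℤ ℤ (subsetIncl (U v)) k (g v))) ∧
        (∀ v, kroneckerPairing ℤ ℤ (Y v) k (u v) (singularHomology.map ℤ ℤ (π v) k
          (singularHomology.map ℤ ℤ (subsetIncl (U v)) k (g v))) = 2) ∧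
        ∀ v w, v ≠ w → |kroneckerPairing ℤ ℤ (Y w) k (u w)
          (singularHomology.map ℤ ℤ (π w) k
            (singularHomology.map ℤ ℤ (subsetIncl (U v)) k (g v)))| =
          kosinskiGamma8 v w := by
  obtain ⟨m, rfl⟩ : ∃ m, n = m + 1 := ⟨n - 1, by omega⟩
  haveI := t2Space_bd hk hc hkn hε
  haveI := secondCountableTopology_bd hk hc hkn hε
  haveI := compactSpace_bd hk hc hkn hε hε'
  haveI := nonempty_bd hk hc hkn hε hε'
  let cW := Wc.nullCobordism hk hc hkn hε hε'
  have hk1 : 1 ≤ k := by omega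
  have hk0 : k ≠ 0 := by omega
  -- ### the coherent orientation, the orientation of the interior and the class `z`
  obtain ⟨μ₀, ν, hcompat⟩ := exists_orientation_rho_lt hk hc hkn hke hε
  let Xs : Set (PV k c hk hc hkn) := {p | rho hk hc hkn p < ε}
  -- the two models of the interior and `{ρ < ε}`
  let θ : cW.Interior ≃ₜ ↥Xs := interiorHomeomorphRhoLt hk hc hkn hε
  let θ₂ : cW.Interior ≃ₜ ManifoldInterior (m + 1) cW.W :=
    { toFun := fun v => ⟨v.val, v.property⟩
      invFun := fun y => ⟨y.1, y.2⟩
      left_inv := fun _ => rfl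
      right_inv := fun _ => rfl
      continuous_toFun := InteriorManifold.continuous_val.subtype_mk _
      continuous_invFun := InteriorManifold.continuous_iff_comp_val.2 continuous_subtype_val }
  let Θ : ↥Xs ≃ₜ ManifoldInterior (m + 1) cW.W := θ.symm.trans θ₂
  let ΘCM : C(↥Xs, ManifoldInterior (m + 1) cW.W) := ⟨Θ, Θ.continuous⟩
  let νW : HomologicalOrientation ℤ cW.Interior (m + 1 + 1) := ν.comap θ
  obtain ⟨z, hz, hzloc⟩ := cW.exists_isRelFundamentalClass_of_interiorOrientation νW
  -- `ẑ` and its local classes at finite points: `ẑ|_{Θ p} = (ofInterior ∘ Θ)₊ ν_p`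
  let zh := cW.closedModelClass ℤ ℤ (Nat.le_add_left 1 m) z
  let F : C(↥Xs, ClosedModel (m + 1) cW.W) := (NullCobordism.ofInteriorCM cW).comp ΘCM
  have hFemb : IsOpenEmbedding F := (NullCobordism.isOpenEmbedding_ofInteriorCM cW).comp Θ.isOpenEmbedding
  have hzhloc : ∀ (p : ↥Xs) (q : ClosedModel (m + 1) cW.W) (hq : F p = q)
      (h : MapsTo F ({p}ᶜ : Set _) ({q}ᶜ : Set _)),
      singularHomology.toLocal ℤ ℤ q (m + 1 + 1) zh = relativeSingularHomology.map ℤ ℤ F h (m + 1 + 1)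
        (ν.localClass p) := by
    intro p q hq h
    subst hq
    -- `F ∘ θ : Interior → Ŵ` is pointwise the inclusion of the interior
    let F' : C(cW.Interior, ClosedModel (m + 1) cW.W) := F.comp (θ : C(cW.Interior, ↥Xs))
    have hF'pt : ∀ v, F' v = ClosedModel.ofInterior (⟨v.val, v.property⟩ : ManifoldInterior (m + 1) cW.W) := by
      intro v
      change ClosedModel.ofInterior (θ₂ (θ.symm (θ v))) = _
      rw [θ.symm_apply_apply]
      rfl
    have mθ : MapsTo (θ : C(cW.Interior, ↥Xs)) ({θ.symm p}ᶜ : Set _) ({p}ᶜ : Set _) :=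
      AlgebraicTopology.SingularHomology.mapsTo_compl_singleton_of_injective
        θ.injective (θ.apply_symm_apply p)
    have key := cW.toLocal_closedModelClass_eq_map_of_interiorOrientation νW z hzloc F' hF'pt (Θ p)
      (h.comp mθ)
    refine key.trans ?_
    have e1 : relativeSingularHomology.map ℤ ℤ F' (h.comp mθ) (m + 1 + 1) =
        relativeSingularHomology.map ℤ ℤ (θ : C(cW.Interior, ↥Xs)) mθ (m + 1 + 1) ≫
          relativeSingularHomology.map ℤ ℤ F h (m + 1 + 1) :=
      relativeSingularHomology.map_comp ℤ ℤ (θ : C(cW.Interior, ↥Xs)) F mθ h (m + 1 + 1)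
    refine (ConcreteCategory.congr_hom e1 _).trans ?_
    change relativeSingularHomology.map ℤ ℤ F h (m + 1 + 1)
        (relativeSingularHomology.map ℤ ℤ (θ : C(cW.Interior, ↥Xs)) mθ (m + 1 + 1)
          ((ν.comap θ).localClass (θ.symm p))) =
      relativeSingularHomology.map ℤ ℤ F h (m + 1 + 1) (ν.localClass p)
    congr 1
    -- `θ₊ (ν.comap θ)_{θ⁻¹ p} = ν_p`
    rw [HomologicalOrientation.comap_localClass]
    have aux : ∀ (p' : ↥Xs) (hp : p' = p)
        (h1 : MapsTo (θ.symm : C(↥Xs, cW.Interior)) ({p'}ᶜ : Set _) ({θ.symm p}ᶜ : Set _))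
        (h2 : MapsTo (θ : C(cW.Interior, ↥Xs)) ({θ.symm p}ᶜ : Set _) ({p}ᶜ : Set _)),
        relativeSingularHomology.map ℤ ℤ (θ : C(cW.Interior, ↥Xs)) h2 (m + 1 + 1)
          (relativeSingularHomology.map ℤ ℤ (θ.symm : C(↥Xs, cW.Interior)) h1 (m + 1 + 1) (ν.localClass p')) =
          ν.localClass p := by
      intro p' hp h1 h2
      subst hp
      rw [← ModuleCat.comp_apply, ← relativeSingularHomology.map_comp]
      have hid : (θ : C(cW.Interior, ↥Xs)).comp (θ.symm : C(↥Xs, cW.Interior)) = ContinuousMap.id _ := by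
        ext x : 1; exact θ.apply_symm_apply x
      rw [relativeSingularHomology.map_congr ℤ ℤ hid (h2.comp h1) (mapsTo_id _) (m + 1 + 1),
        relativeSingularHomology.map_id]
      rfl
    exact aux (θ (θ.symm p)) (θ.apply_symm_apply p) _ mθ
  refine ⟨z, hz, ?_⟩
  -- ### the tube parameter `c' = √(1 - ε)` and the piece embeddings
  let c' : ℝ := Real.sqrt (1 - ε)
  have hc' : |c'| < 1 := abs_sqrt_one_sub_lt_one hε
  have hc'1 : c' < 1 := (abs_lt.1 hc').2
  have hc'0 : 0 ≤ c' := Real.sqrt_nonneg _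
  have hcc' : c ≤ c' := le_sqrt_one_sub hc hε'
  have hO : ∀ (v : Fin 8), ∀ x ∈ (⟨openTube k c', isOpen_openTube k c'⟩ : Opens ((Metric.sphere (0 : EuclideanSpace ℝ (Fin (k + 1))) 1) ×
      (Metric.sphere (0 : EuclideanSpace ℝ (Fin (k + 1))) 1))), c < fibHt x ∧ rhoHat k c v x < ε :=
    fun v x hx => lt_fibHt_and_rhoHat_lt hc hε hε' v x hx
  let O : Opens ((Metric.sphere (0 : EuclideanSpace ℝ (Fin (k + 1))) 1) ×
      (Metric.sphere (0 : EuclideanSpace ℝ (Fin (k + 1))) 1)) := ⟨openTube k c', isOpen_openTube k c'⟩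
  have hΦemb : ∀ v : Fin 8, IsOpenEmbedding fun x : ↥O =>
      (⟨ι hk hc hkn v ⟨x.1, (hO v x.1 x.2).1⟩, pieceMap_mem hk hc hkn v x.1 (hO v x.1 x.2)⟩ : ↥Xs) :=
    fun v => isOpenEmbedding_pieceMap hk hc hkn v O (hO v)
  let Φ : ∀ v : Fin 8, C(↥O, ↥Xs) := fun v =>
    ⟨fun x => ⟨ι hk hc hkn v ⟨x.1, (hO v x.1 x.2).1⟩, pieceMap_mem hk hc hkn v x.1 (hO v x.1 x.2)⟩,
      (hΦemb v).continuous⟩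
  have hΦval : ∀ (v : Fin 8) (x : ↥O), (Φ v x).1 = ι hk hc hkn v ⟨x.1, (hO v x.1 x.2).1⟩ := fun v x => rfl
  -- the open tube as the interior of the compact tube
  let oTH : ↥(openTube k c') ≃ₜ ManifoldInterior (m + 1) (Tube k (m + 1) hkn hc') :=
    openTubeHomeomorph (hkn := hkn) hc'
  -- the open embeddings `E v : int N_{c'} → Ŵ`
  let E : ∀ v : Fin 8, C(ManifoldInterior (m + 1) (Tube k (m + 1) hkn hc'), ClosedModel (m + 1) cW.W) :=
    fun v => F.comp ((Φ v).comp (oTH.symm : C(ManifoldInterior (m + 1) (Tube k (m + 1) hkn hc'), ↥(openTube k c'))))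
   
  have hEemb : ∀ v, IsOpenEmbedding (E v) := fun v =>
    hFemb.comp ((hΦemb v).comp oTH.symm.isOpenEmbedding)
  have hEapply : ∀ v y, E v y = F (Φ v (oTH.symm y)) := fun v y => rfl
  -- the tube's null-cobordism and instances
  haveI : Nonempty ↥((𝓡∂ (m + 1 + 1)).boundary (Tube k (m + 1) hkn hc')) :=
    Tube.nonempty_boundary hc' hk1
  haveI : CompactSpace ↥((𝓡∂ (m + 1 + 1)).boundary (Tube k (m + 1) hkn hc')) :=
    SmaleHomologySpheres.compactSpace_boundary (m + 1) (Tube k (m + 1) hkn hc')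
  -- ### the collapses (one per vertex) with the transfer `π₊ ẑ = ẑ_w`
  -- the vertex package, read in the coherent orientation `μ₀` (the SAME sign `r` for all `v`)
  obtain ⟨w, ξ, r, hw, hreq, hr, hξZ, hloc, hclass, hcapw, hdiag2, hslice, htors⟩ :=
    Tube.exists_vertexData_sign (hkm := hkn) hc' hk hke μ₀
  have hπ : ∀ v : Fin 8, ∃ π : C(ClosedModel (m + 1) cW.W, ThomSp k (m + 1) hkn hc'),
      (∀ y, π (E v y) = ClosedModel.ofInterior y) ∧
      (∀ x, x ∉ range (E v) → π x = ClosedModel.infty) ∧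
      singularHomology.map ℤ ℤ π (m + 1 + 1) zh =
        (SmaleHomologySpheres.nullCobordismOfBoundary (m + 1) (Tube k (m + 1) hkn hc')).closedModelClass
          ℤ ℤ (Nat.le_add_left 1 m) w := by
    intro v
    obtain ⟨π, hπE, hπout, hπmaps, hπtrans⟩ :=
      (SmaleHomologySpheres.nullCobordismOfBoundary (m + 1) (Tube k (m + 1) hkn hc')).exists_ambientCollapse
        (E v) (hEemb v)
    refine ⟨π, hπE, hπout, hπtrans zh w fun y => ?_⟩
    obtain ⟨ζ, hζμ, hζw⟩ := hloc y
    refine ⟨ζ, ?_, hζw⟩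
    -- `ẑ|_{E y} = (E v)₊ ζ`: through `ν` (on `{ρ < ε}`) and `μ₀|O` (on the open tube)
    let x : ↥(openTube k c') := oTH.symm y
    -- `oTH⁻¹₊ ζ = μ₀_x|O` (excised class)
    have mval : MapsTo (subsetIncl (openTube k c')) ({x}ᶜ : Set ↥(openTube k c')) ({(x : _ × _)}ᶜ : Set _) :=
      LocalFamily.mapsTo_compl_pt Subtype.val_injective _
    have msymm : MapsTo (oTH.symm : C(ManifoldInterior (m + 1) (Tube k (m + 1) hkn hc'), ↥(openTube k c')))
        ({y}ᶜ : Set _) ({x}ᶜ : Set _) :=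
      AlgebraicTopology.SingularHomology.mapsTo_compl_singleton_of_injective oTH.symm.injective rfl
    have hζ' : relativeSingularHomology.map ℤ ℤ
        (oTH.symm : C(ManifoldInterior (m + 1) (Tube k (m + 1) hkn hc'), ↥(openTube k c'))) msymm (m + 1 + 1) ζ =
        (localHomology.openSubsetIso ℤ ℤ O.2 x.2 (m + 1 + 1)).inv (μ₀.localClass x.1) := by
      apply map_subsetIncl_localHomology_injective (N := m + 1 + 1) O.2 x.2 mval
      have e1 : (subsetIncl (openTube k c')).comp
          (oTH.symm : C(ManifoldInterior (m + 1) (Tube k (m + 1) hkn hc'), ↥(openTube k c'))) =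
          (⟨fun y : ManifoldInterior (m + 1) (Tube k (m + 1) hkn hc') => Tube.toProd hc' y.1,
            (contMDiff_out.continuous.comp (RegularSublevel.continuous_incl _)).comp
              continuous_subtype_val⟩ : C(_, _)) := by
        ext y : 1; rfl
      rw [map_subsetIncl_openSubsetIso_inv O.2 x.2 mval, ← ModuleCat.comp_apply,
        ← relativeSingularHomology.map_comp,
        relativeSingularHomology.map_congr ℤ ℤ e1 (mval.comp msymm)
          (LocalFamily.mapsTo_compl_pt ((Tube.toProd_injective hc').comp Subtype.val_injective) y) (m + 1 + 1)]
      exact hζμ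
    -- `(Φ v)₊ (μ₀_x|O) = ν_{Φ v x}`
    have mΦ : MapsTo (Φ v) ({x}ᶜ : Set ↥O) ({Φ v x}ᶜ : Set _) :=
      AlgebraicTopology.SingularHomology.mapsTo_compl_singleton_of_injective (hΦemb v).injective rfl
    have hΦν := hcompat v O (hO v) (Φ v) (hΦval v) x (Φ v x) rfl mΦ
    -- `ẑ|_{F (Φ v x)} = F₊ ν_{Φ v x}`
    have mF : MapsTo F ({Φ v x}ᶜ : Set _) ({E v y}ᶜ : Set _) :=
      AlgebraicTopology.SingularHomology.mapsTo_compl_singleton_of_injective hFemb.injective rfl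
    have hFz := hzhloc (Φ v x) (E v y) rfl mF
    refine hFz.trans ?_
    have step : relativeSingularHomology.map ℤ ℤ F mF (m + 1 + 1) (ν.localClass (Φ v x)) =
        relativeSingularHomology.map ℤ ℤ F mF (m + 1 + 1)
          (relativeSingularHomology.map ℤ ℤ (Φ v) mΦ (m + 1 + 1)
            (relativeSingularHomology.map ℤ ℤ
              (oTH.symm : C(ManifoldInterior (m + 1) (Tube k (m + 1) hkn hc'), ↥(openTube k c'))) msymm
              (m + 1 + 1) ζ)) := by
      rw [hζ', hΦν]
    refine step.trans ?_
    exact relativeSingularHomology_map_map_map_eq _ (Φ v) F (E v) rfl msymm mΦ mF _ (m + 1 + 1) ζ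
  choose π hπE hπout hπz using hπ
  -- ### the datum
  -- core spheres: `g v = (E v ∘ oTH ∘ diag)₊ [Sᵏ]` read in `U v = range (E v)`
  let ψ : ∀ v : Fin 8, ↥(openTube k c') ≃ₜ ↥(range (E v)) := fun v =>
    oTH.trans (hEemb v).toIsEmbedding.toHomeomorph
  have hψval : ∀ (v : Fin 8) (x : ↥(openTube k c')), ((ψ v x : ↥(range (E v))) : ClosedModel (m + 1) cW.W) = E v (oTH x) :=
    fun v x => rfl
  let dg : C(Metric.sphere (0 : EuclideanSpace ℝ (Fin (k + 1))) 1, ↥(openTube k c')) :=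
    ⟨fun p => ⟨(p, p), diagonal_subset_openTube hc'1 rfl⟩, by fun_prop⟩
  -- ### the composites `π_w ∘ E_v ∘ diag` read on `Sᵏ`
  have hcompF : ∀ v w : Fin 8, (π w).comp ((subsetIncl (range (E v))).comp
      (((ψ v : C(↥(openTube k c'), ↥(range (E v)))).comp dg))) = (π w).comp (F.comp ((Φ v).comp dg)) := by
    intro v w
    ext p : 1
    change π w (E v (oTH (dg p))) = π w (F (Φ v (dg p)))
    rw [hEapply, Homeomorph.symm_apply_apply]
  have hmapF : ∀ v w : Fin 8, singularHomology.map ℤ ℤ (π w) k (singularHomology.map ℤ ℤ (subsetIncl (range (E v))) k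
      (singularHomology.map ℤ ℤ ((ψ v : C(↥(openTube k c'), ↥(range (E v)))).comp dg) k (μS hk).fundamentalClass)) =
      singularHomology.map ℤ ℤ ((π w).comp (F.comp ((Φ v).comp dg))) k (μS hk).fundamentalClass := by
    intro v w
    simp only [← hcompF, singularHomology.map_comp, ModuleCat.comp_apply]
  -- the vertex: `πᵥ ∘ Eᵥ ∘ diag = tubeCollapse ∘ diag` pointwise
  have hvertex : ∀ v : Fin 8, (π v).comp (F.comp ((Φ v).comp dg)) = (tubeCollapse (hkn := hkn) hc').comp (diagX k) := by
    intro v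
    ext p : 1
    change π v (F (Φ v (dg p))) = tubeCollapse (hkn := hkn) hc' ((dg p : ↥(openTube k c')) : _ × _)
    rw [tubeCollapse_coe, ← oTH.symm_apply_apply (dg p), ← hEapply, hπE, Homeomorph.symm_apply_apply]
  have ht : ∀ v : Fin 8, singularHomology.map ℤ ℤ (π v) k (singularHomology.map ℤ ℤ (subsetIncl (range (E v))) k
      (singularHomology.map ℤ ℤ ((ψ v : C(↥(openTube k c'), ↥(range (E v)))).comp dg) k (μS hk).fundamentalClass)) =
      singularHomology.map ℤ ℤ (tubeCollapse (hkn := hkn) hc') k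
        (singularHomology.map ℤ ℤ (diagX k) k (μS hk).fundamentalClass) := by
    intro v
    rw [hmapF, hvertex, singularHomology.map_comp, ModuleCat.comp_apply]
  refine ⟨fun _ => ThomSp k (m + 1) hkn hc', fun _ => inferInstance, π, fun _ => ξ,
    fun _ => thomDiag (openTubeHomeomorph (hkn := hkn) hc'), fun v => range (E v),
    fun v => singularHomology.map ℤ ℤ ((ψ v : C(↥(openTube k c'), ↥(range (E v)))).comp dg) k (μS hk).fundamentalClass,
    r, hr, fun _ => hξZ, fun v => (hEemb v).isOpen_range, ?_, ?_, ?_, ?_, ?_, ?_, ?_⟩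
  · -- `π⁻¹(Z)` is closed
    intro v
    refine IsClosed.preimage (π v).continuous ?_
    rw [← isOpen_compl_iff]
    exact isOpen_compl_thomDiag (isOpen_openTube k c') _ (diagonal_subset_openTube hc'1)
  · -- `π⁻¹(Z) ⊆ range (E v)` (`∞ ∉ Z`)
    intro v x hx
    by_contra hxr
    rw [mem_preimage, hπout v x hxr] at hx
    exact infty_not_mem_thomDiag hc' hx
  · -- `Hₖ(U v) = ℤ g v`
    intro v y
    exact SphereProd.OpenTube.exists_eq_zsmul_map_homeomorph_diag hk (by linarith) hc'1 (ψ v) y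
  · -- torsion-freeness of the collapsed core sphere
    intro v a ha
    rw [ht v] at ha
    exact htors a ha
  · -- `ξ ⌢ πᵥ₊ ẑ = r • tᵥ`
    intro v
    show capProduct hkn ξ (singularHomology.map ℤ ℤ (π v) (m + 1 + 1) zh) = _
    rw [hπz v, ht v]
    exact hcapw
  · -- `⟨ξ, tᵥ⟩ = 2` (the Euler number of `TS²ᵐ`, (12.4))
    intro v
    rw [ht v]
    exact hdiag2
  · -- `|⟨ξ_w, π_w₊ gᵥ⟩| = Γ₈(v, w)` ((12.3))
    intro v w hvw
    rw [hmapF]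
    have hΓ01 : ∀ v w : Fin 8, v ≠ w → kosinskiGamma8 v w = 0 ∨ kosinskiGamma8 v w = 1 := by decide
    -- a point of `Eᵥ(core)` in the range of `E_w` forces an identification of the two tubes
    have hrange : ∀ (p : Metric.sphere (0 : EuclideanSpace ℝ (Fin (k + 1))) 1),
        F (Φ v (dg p)) ∈ range (E w) →
          ∃ x'' : ↥(openTube k c'), ι hk hc hkn w ⟨x''.1, (hO w x''.1 x''.2).1⟩ =
            ι hk hc hkn v ⟨(p, p), (hO v _ (dg p).2).1⟩ := by
      intro p hp
      obtain ⟨y'', hy''⟩ := hp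
      refine ⟨oTH.symm y'', ?_⟩
      rw [hEapply] at hy''
      have h1 : Φ w (oTH.symm y'') = Φ v (dg p) := hFemb.injective hy''
      exact congrArg Subtype.val h1
    rcases hΓ01 v w hvw with hΓ | hΓ
    · -- non-adjacent: the composite is constant `∞`
      have hconst : (π w).comp (F.comp ((Φ v).comp dg)) =
          ContinuousMap.const _ (OnePoint.infty : ThomSp k (m + 1) hkn hc') := by
        ext p : 1
        change π w (F (Φ v (dg p))) = OnePoint.infty
        apply hπout w
        intro hp
        obtain ⟨x'', hx''⟩ := hrange p hp
        have hdis := disjoint_range_ι hk hc hkn hvw (by rw [hΓ]; norm_num)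
        exact Set.disjoint_left.1 hdis ⟨_, rfl⟩ ⟨_, hx''⟩
      rw [hconst, singularHomology_map_const_eq_zero _ hk0, hΓ]
      simp
    · -- adjacent: the composite is the fibre sphere `x ↦ (e, x)` collapsed
      let e : Metric.sphere (0 : EuclideanSpace ℝ (Fin (k + 1))) 1 := pole k (ecol v w).val
      have hslice' := (hslice e).2
      have hfib : ∀ p : Metric.sphere (0 : EuclideanSpace ℝ (Fin (k + 1))) 1,
          c < ⟪(p : EuclideanSpace ℝ (Fin (k + 1))), (e : EuclideanSpace ℝ (Fin (k + 1)))⟫ →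
            ((p, p) : _ × _) ∈ dom k c (ecol v w) := by
        intro p hp
        refine ⟨hp, ?_⟩
        change c < ⟪(p : EuclideanSpace ℝ (Fin (k + 1))), (p : EuclideanSpace ℝ (Fin (k + 1)))⟫
        rw [real_inner_self_eq_norm_sq, norm_eq_of_mem_sphere p, one_pow]; exact hc.lt_one
      have hident : ∀ (p : Metric.sphere (0 : EuclideanSpace ℝ (Fin (k + 1))) 1)
          (hp : c < ⟪(p : EuclideanSpace ℝ (Fin (k + 1))), (e : EuclideanSpace ℝ (Fin (k + 1)))⟫) (h1 h2),
          ι hk hc hkn v ⟨(p, p), h1⟩ = ι hk hc hkn w ⟨(e, p), h2⟩ := by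
        intro p hp h1 h2
        have hd := hfib p hp
        rw [← ι_pm hk hc hkn v w hΓ (x := ⟨(p, p), h1⟩) hd]
        congr 1
        apply Subtype.ext
        rw [coe_pm_of_mem hc hd]
        exact plumbMap_diag' e p (lt_of_le_of_lt hc.neg_one_le hp)
      have hcomp : (π w).comp (F.comp ((Φ v).comp dg)) =
          (tubeCollapse (hkn := hkn) hc').comp ⟨fun x => (e, x), by fun_prop⟩ := by
        ext p : 1
        change π w (F (Φ v (dg p))) = tubeCollapse (hkn := hkn) hc' (e, p)
        by_cases hp : c' < ⟪(p : EuclideanSpace ℝ (Fin (k + 1))), (e : EuclideanSpace ℝ (Fin (k + 1)))⟫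
        · -- the core point `(p, p)` is the fibre point `(e, p)` of the `w`-th tube
          have hpc : c < ⟪(p : EuclideanSpace ℝ (Fin (k + 1))), (e : EuclideanSpace ℝ (Fin (k + 1)))⟫ :=
            lt_of_le_of_lt hcc' hp
          have h2 : ((e, p) : (Metric.sphere (0 : EuclideanSpace ℝ (Fin (k + 1))) 1) ×
              (Metric.sphere (0 : EuclideanSpace ℝ (Fin (k + 1))) 1)) ∈ openTube k c' := by
            change c' < ⟪(e : EuclideanSpace ℝ (Fin (k + 1))), (p : EuclideanSpace ℝ (Fin (k + 1)))⟫
            rwa [real_inner_comm]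
          have hΦeq : Φ v (dg p) = Φ w ⟨(e, p), h2⟩ := Subtype.ext (hident p hpc _ _)
          have hEF : F (Φ w ⟨(e, p), h2⟩) = E w (oTH ⟨(e, p), h2⟩) := by
            rw [hEapply, Homeomorph.symm_apply_apply]
          rw [hΦeq, hEF, hπE w]
          change _ = tubeCollapse (hkn := hkn) hc' ((⟨(e, p), h2⟩ : ↥(openTube k c')) : _ × _)
          rw [tubeCollapse_coe]
        · -- both sides are `∞`
          have hnot : ((e, p) : (Metric.sphere (0 : EuclideanSpace ℝ (Fin (k + 1))) 1) ×
              (Metric.sphere (0 : EuclideanSpace ℝ (Fin (k + 1))) 1)) ∉ openTube k c' := by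
            change ¬ c' < ⟪(e : EuclideanSpace ℝ (Fin (k + 1))), (p : EuclideanSpace ℝ (Fin (k + 1)))⟫
            rwa [real_inner_comm]
          rw [tubeCollapse_of_not_mem (hkn := hkn) hc' hnot]
          apply hπout w
          intro hmem
          obtain ⟨x'', hx''⟩ := hrange p hmem
          rcases (ι_eq_ι_iff hk hc hkn).1 hx'' with ⟨hwv, -⟩ | ⟨-, hdom, hpm⟩
          · exact hvw hwv.symm
          · have hecol : ecol w v = ecol v w := ecol_comm w v
            have he' : pole k (ecol w v).val = e := by
              show pole k (ecol w v).val = pole k (ecol v w).val; rw [hecol]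
            have hval : ((p, p) : (Metric.sphere (0 : EuclideanSpace ℝ (Fin (k + 1))) 1) ×
                (Metric.sphere (0 : EuclideanSpace ℝ (Fin (k + 1))) 1)) = plumbMap e x''.1 := by
              have h3 := congrArg Subtype.val hpm
              rw [coe_pm_of_mem hc hdom, he'] at h3
              exact h3
            have hpd : ((p, p) : (Metric.sphere (0 : EuclideanSpace ℝ (Fin (k + 1))) 1) ×
                (Metric.sphere (0 : EuclideanSpace ℝ (Fin (k + 1))) 1)) ∈ dom k c (ecol w v) := by
              have h4 := pm_mem_dom hc hdom
              rw [← hpm] at h4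
              exact h4
            have hpc : c < ⟪(p : EuclideanSpace ℝ (Fin (k + 1))), (e : EuclideanSpace ℝ (Fin (k + 1)))⟫ := by
              have h5 := hpd.1
              rw [baseHt_apply, he'] at h5
              exact h5
            have hx1 : plumbMap e (p, p) = x''.1 := by
              have h6 := congrArg (plumbMap e) hval
              rw [plumbMap_plumbMap] at h6
              exact h6
            rw [plumbMap_diag' e p (lt_of_le_of_lt hc.neg_one_le hpc)] at hx1
            apply hnot
            rw [hx1]
            exact x''.2
      rw [hcomp, hslice', hΓ]
      simp


end Plumbing

end Literature.Topology.FourManifolds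

/-!
## Part 3. Kosinski's `M(4m)`: the `E₈` fact from the plumbing, modulo `π₁(∂M(4m)) = 1` and stable parallelisability

Topic `Literature/Topology/FourManifolds` (fact seat of
`Literature.Topology.FourManifolds.HomotopySphere.exists_intersectionForm_equivalent_e8Form`,
A. Kosinski, *Differential Manifolds* (1993), VI.12 pp. 119–122, IX.(7.5), X §6 p. 216). The
assembly of the tree's construction of `M(4m)`: the compact plumbing `W = {ρ ≤ ε}`
(`Plumbing.Wc`, `PlumbingFunction.lean`) of eight tubes of the diagonal of `S²ᵐ × S²ᵐ` along the
`E₈` tree (`PlumbingGlue.lean`), with `c = 3/4`, `ε = ε₀/2` (a level strictly below `ε₀`, so that regular levels remain above it), has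

* the homology of `⋁₈ S²ᵐ` (`PlumbingHomology.lean`: `Hⱼ(W) = 0` for `0 < j ≠ 2m`,
  `H₂ₘ(W) ≅ ℤ⁸`; Kosinski VI.(11.5)), and is connected;
* a relative fundamental class and the KRONECKER DATUM of the `E₈` table
  (`Plumbing.exists_kroneckerData`, `PlumbingKroneckerData.lean`: `⟨uᵥ, πᵥ₊ gᵥ⟩ = 2`,
  `|⟨u_w, π_w₊ gᵥ⟩| = Γ₈(v, w)`, one sign `r`; Kosinski VI.(12.3)–(12.4)),

so that the Kronecker form of the table
(`HomotopySphere.exists_intersectionForm_equivalent_e8Form_of_kroneckerData`,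
`HomotopySpheresE8KroneckerTable.lean`; Kosinski VI.(12.2), IX.(7.5), X §6) yields the named
fact as soon as the two remaining geometric inputs of Kosinski's argument are supplied for this
`W`: **`∂M(4m)` is simply connected** (VI.(12.1): `k > 2`; then `∂W` is smoothly orientable,
`isOrientable_of_simplyConnectedSpace_holds`) and **`M(4m)` is stably parallelisable**
(IX.(7.5): the plumbing of copies of `τ(S²ᵐ)` is parallelisable). Both are taken here as
HYPOTHESES about the tree's concrete `W` (they are being proved in sibling files of the
construction); no named fact is introduced.

* **`HomotopySphere.exists_intersectionForm_equivalent_e8Form_of_plumbing`** — the named fact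
  from `π₁(∂W) = 1` and `IsStablyParallelizable W` for the tree's `W = M(4m)`, all `m ≥ 2`.

Everything is proved; no definitions, no named facts (D-0026).

## References

* A. Kosinski, *Differential Manifolds*, Academic Press 1993, VI.(11.5), VI.12 pp. 119–122
  ((12.1)–(12.4)), IX.(7.5) p. 188, X §6 p. 216. [Kosinski1993]
* M. Kervaire, J. Milnor, *Groups of homotopy spheres: I*, Ann. of Math. 77 (1963), §7.
  [KervaireMilnorAnnals1963]
-/

open scoped Manifold ContDiff Topology
open Set Function CategoryTheory CategoryTheory.Limits Topology


namespace Literature.Topology.FourManifolds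

open Literature.AlgebraicTopology.SingularHomology

namespace HomotopySphere

/-- **The `E₈` fact from Kosinski's plumbing, modulo `π₁(∂M(4m)) = 1` and stable
parallelisability.** Let `W = M(4m) = {ρ ≤ ε₀/2}` be the tree's compact `E₈` plumbing of eight
tubes of the diagonal of `S²ᵐ × S²ᵐ` (`Plumbing.Wc` with `c = 3/4`, `ε = ε₀/2`, `k = 2m`,
`k + k = n + 1`). If for all `m ≥ 2` (`k = 2m ≥ 4`) the boundary `∂W` is simply
connected (Kosinski VI.(12.1): needs `k > 2`; for `m = 1` the boundary is Poincaré's homology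
sphere) and `W` is stably parallelisable (IX.(7.5)), then for every
`n + 1 = 4m`, `m > 1`, some homotopy `n`-sphere bounds a stably parallelisable `W` with
intersection form `E₈`: `HomotopySphere.exists_intersectionForm_equivalent_e8Form`. Proof:
`…_of_kroneckerData` with `M = ∂W` (compact, simply connected, hence smoothly oriented),
`c = Wc.nullCobordism`, the homology of `W` (`PlumbingHomology.lean`) and the Kronecker datum
`Plumbing.exists_kroneckerData`. [cite: Kosinski1993, VI.12 pp. 119–122 ((12.1)–(12.4)), VI.(11.5), IX.(7.5) p. 188, X §6 p. 216] -/
theorem exists_intersectionForm_equivalent_e8Form_of_plumbing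
    (hsc : ∀ (m n : ℕ) (_hm : 1 < m) (hk : 2 ≤ 2 * m) (hkn : 2 * m + 2 * m = n + 1),
      SimplyConnectedSpace (Plumbing.Wc.bd hk Plumbing.isParam_three_quarters hkn
        (half_pos (Plumbing.epsMax_pos Plumbing.isParam_three_quarters))).carrier)
    (hpar : ∀ (m n : ℕ) (_hm : 1 < m) (hk : 2 ≤ 2 * m) (hkn : 2 * m + 2 * m = n + 1),
      IsStablyParallelizable (𝓡∂ (n + 1)) (Plumbing.Wc hk Plumbing.isParam_three_quarters hkn
        (half_pos (Plumbing.epsMax_pos Plumbing.isParam_three_quarters)))) :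
    exists_intersectionForm_equivalent_e8Form := by
  refine exists_intersectionForm_equivalent_e8Form_of_kroneckerData fun n m h hm => ?_
  have hk : 2 ≤ 2 * m := by omega
  have hkn : 2 * m + 2 * m = n + 1 := by omega
  have hke : Even (2 * m) := even_two_mul m
  have hc : Plumbing.IsParam (3 / 4 : ℝ) := Plumbing.isParam_three_quarters
  have hε : 0 < Plumbing.epsMax (3 / 4 : ℝ) / 2 := half_pos (Plumbing.epsMax_pos hc)
  have hε' : Plumbing.epsMax (3 / 4 : ℝ) / 2 ≤ Plumbing.epsMax (3 / 4 : ℝ) :=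
    half_le_self (Plumbing.epsMax_pos hc).le
  -- the boundary `M = ∂W` and its instances
  haveI := Plumbing.t2Space_bd hk hc hkn hε
  haveI := Plumbing.secondCountableTopology_bd hk hc hkn hε
  haveI := Plumbing.compactSpace_bd hk hc hkn hε hε'
  haveI : SimplyConnectedSpace (Plumbing.Wc.bd hk hc hkn hε).carrier := hsc m n hm hk hkn
  obtain ⟨o⟩ := isOrientable_of_simplyConnectedSpace_holds (I := 𝓡 n)
    (M := (Plumbing.Wc.bd hk hc hkn hε).carrier)
  -- the Kronecker datum and the homology of `W`
  obtain ⟨z, hz, Y, iY, π, u, Z, U, g, r, hdat⟩ :=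
    Plumbing.exists_kroneckerData hk hke hc hkn hε hε' (show 1 ≤ n by omega)
  obtain ⟨hF, -, hrank⟩ := Plumbing.free_finrank_singularHomology_Wc hk hc hkn hε hε'
  refine ⟨(Plumbing.Wc.bd hk hc hkn hε).carrier, inferInstance, inferInstance, inferInstance,
    inferInstance, inferInstance, inferInstance, inferInstance, o,
    Plumbing.Wc.nullCobordism hk hc hkn hε hε', Plumbing.connectedSpace_Wc hk hc hkn hε hε', z,
    hpar m n hm hk hkn, hz, fun i hi hik => ?_, hF, hrank.le, Y, iY, π, u, Z, U, g, r, hdat⟩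
  exact Plumbing.isZero_singularHomology_Wc hk hc hkn hε hε' (Nat.pos_iff_ne_zero.1 hi) hik

end HomotopySphere

end Literature.Topology.FourManifolds
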